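import Mathlib.Analysis.SpecialFunctions.Integrals.Basic
import Mathlib.Analysis.SpecialFunctions.Log.NegMulLog
import Mathlib.MeasureTheory.Function.Jacobian
import Mathlib.MeasureTheory.Integral.Marginal
import Mathlib.MeasureTheory.Measure.Haar.Unique
import Mathlib.MeasureTheory.Measure.Prod
import Literature.Analysis.SpecialFunctions.TanhPartialFractions
import Literature.NumberTheory.Transcendental.PennerWeilPeterssonVolumes
import HarnessLib

/-!
# Proofs of Penner's Weil–Petersson volume integrals (Penner 1992, §4.1 and §5)

Part I (this docstring and the first half of the file): the torus integral
`⅓ ∫_D dA dB/((A+B)(½−A)(½−B)) = π²/6` (§4.1), `penner_torus_integral_holds`.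
Part II (second half, own sectioning docstring `Part II` below, sub-namespace `PennerDoubleTorus`):
the twice-punctured-torus integral of Prop. 5.1.2 / Thm. 5.2.1, `= π⁴/8`,
`penner_doubleTorus_integral_holds`.

## Part I: the torus integral (Penner 1992, §4.1)

Discharges the named fact `Literature.NumberTheory.Transcendental.penner_torus_integral`
(`PennerWeilPeterssonVolumes.lean`) by the theorem `penner_torus_integral_holds`, following the
one-line computation printed in [Penner 1992, §4.1, the display proving Thm. 4.1.1, p. 585]:

  `μ₁¹ = ⅓ ∫_D dA dB/((A+B)(½−A)(½−B)) = −(4/3) ∫₀¹ log x/(1−x²) dx = π²/6`,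

with `D = {A > 0, B > 0, A + B < ½}`.

## The printed argument and its formalization

1. *Inner integration in `B`* (partial fractions,
   `1/((A+B)(½−B)) = (1/(A+B) + 1/(½−B))/(A+½)`): for `0 < A < ½`,
   `∫₀^{½−A} dB/((A+B)(½−A)(½−B)) = −2 log(2A)/((½−A)(½+A))`
   (`penner_inner_integral`, by the primitive `(log(A+B) − log(½−B))/((½−A)(½+A))`).
2. *The homothety `A = x/2`*: `−2 log(2A)/((½−A)(½+A)) = −8 log(2A)/(1−(2A)²)`, so the outer
   integral is `½ · 8 · ∫₀¹ (−log x)/(1−x²) dx = −4 ∫₀¹ log x/(1−x²) dx`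
   (`setLIntegral_Ioo_half_comp_two_mul`).
3. *The classical value*
   `∫₀¹ (−log x)/(1−x²) dx = ∑_{k ≥ 0} ∫₀¹ x²ᵏ(−log x) dx = ∑ 1/(2k+1)² = π²/8`
   (`lintegral_neg_log_div_one_sub_sq`, from `integral_pow_mul_log_zero_one` :
   `∫₀¹ xⁿ log x = −1/(n+1)²`, monotone convergence, and Euler's odd-square sum
   `Literature.Analysis.SpecialFunctions.hasSum_one_div_odd_sq`).

Hence `∫_D = π²/2` (`penner_lintegral_prod`) and `⅓ · π²/2 = π²/6`.

## Design notes

* The two-dimensional bookkeeping (Tonelli on `ℝ × ℝ`, the transfer from `Fin 2 → ℝ` by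
  `MeasureTheory.volume_preserving_finTwoArrow`, the term-wise integration) is done with lower
  Lebesgue integrals (`∫⁻`, values in `ℝ≥0∞`) of the nonnegative integrand, so that no separate
  integrability statement is needed: finiteness is an output of the computation. Only the bounded
  one-dimensional pieces are Bochner/interval integrals (fundamental theorem of calculus), and the
  set integral of the fact is recovered at the end by
  `MeasureTheory.integral_eq_lintegral_of_nonneg_ae`.
* Nothing here is specific to moduli spaces: the Weil–Petersson interpretation of the number
  `π²/6` (Wolpert 1983; Penner 1992, Thm. 4.1.1) is the content of the cited papers, not of this
  file, which only verifies the real-analysis identity as printed.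

## References

* R. C. Penner, *Weil–Petersson volumes*, J. Differential Geom. 35 (1992) 559–608, §4.1 and
  Thm. 4.1.1, p. 585 (key `Penner1992`; held as `doi:10.4310/jdg/1214448257`, page-checked).
-/

noncomputable section

open MeasureTheory Set

open scoped ENNReal

namespace Literature.NumberTheory.Transcendental

/-! ## One-dimensional integrals -/

/-- `∫₀¹ xⁿ log x dx = −1/(n+1)²`, by the primitive `xⁿ⁺¹ log x/(n+1) − xⁿ⁺¹/(n+1)²`, which is
continuous on `[0, 1]` (`x log x → 0`). [folklore] -/
theorem integral_pow_mul_log_zero_one (n : ℕ) :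
    ∫ x in (0 : ℝ)..1, x ^ n * Real.log x = -1 / ((n : ℝ) + 1) ^ 2 := by
  have hcont : ContinuousOn
      (fun x : ℝ => x ^ (n + 1) * Real.log x / ((n : ℝ) + 1) - x ^ (n + 1) / ((n : ℝ) + 1) ^ 2)
      (Icc 0 1) := by
    have hc : Continuous fun x : ℝ =>
        x ^ n * (x * Real.log x) / ((n : ℝ) + 1) - x ^ (n + 1) / ((n : ℝ) + 1) ^ 2 :=
      (((continuous_pow n).mul Real.continuous_mul_log).div_const _).sub
        ((continuous_pow (n + 1)).div_const _)
    refine hc.continuousOn.congr fun x _ => ?_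
    simp only
    ring
  have hderiv : ∀ x ∈ Ioo (0 : ℝ) 1, HasDerivAt
      (fun x : ℝ => x ^ (n + 1) * Real.log x / ((n : ℝ) + 1) - x ^ (n + 1) / ((n : ℝ) + 1) ^ 2)
      (x ^ n * Real.log x) x := by
    intro x hx
    have hx0 : x ≠ 0 := hx.1.ne'
    have h := (((hasDerivAt_pow (n + 1) x).mul (Real.hasDerivAt_log hx0)).div_const
      ((n : ℝ) + 1)).sub ((hasDerivAt_pow (n + 1) x).div_const (((n : ℝ) + 1) ^ 2))
    refine h.congr_deriv ?_
    have hn : (n : ℝ) + 1 ≠ 0 := by positivity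
    push_cast [Nat.add_sub_cancel]
    field_simp
    ring
  have hint : IntervalIntegrable (fun x : ℝ => x ^ n * Real.log x) volume 0 1 :=
    intervalIntegral.intervalIntegrable_log'.continuousOn_mul (continuousOn_pow n)
  rw [intervalIntegral.integral_eq_sub_of_hasDerivAt_of_le zero_le_one hcont hderiv hint]
  simp
  ring

/-- Lintegral form of `integral_pow_mul_log_zero_one`: `∫⁻_{(0,1)} xⁿ(−log x) = 1/(n+1)²`
(the integrand is nonnegative and integrable on `(0, 1)`). [folklore] -/
theorem lintegral_pow_mul_neg_log (n : ℕ) :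
    ∫⁻ x in Ioo (0 : ℝ) 1, ENNReal.ofReal (x ^ n * -Real.log x) =
      ENNReal.ofReal (1 / ((n : ℝ) + 1) ^ 2) := by
  have hint : IntegrableOn (fun x : ℝ => x ^ n * -Real.log x) (Ioo 0 1) := by
    have h : IntervalIntegrable (fun x : ℝ => x ^ n * -Real.log x) volume 0 1 :=
      intervalIntegral.intervalIntegrable_log'.neg.continuousOn_mul (continuousOn_pow n)
    exact ((intervalIntegrable_iff_integrableOn_Ioc_of_le zero_le_one).1 h).mono_set
      Ioo_subset_Ioc_self
  have hnn : 0 ≤ᵐ[volume.restrict (Ioo (0 : ℝ) 1)] fun x : ℝ => x ^ n * -Real.log x :=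
    ae_restrict_of_forall_mem measurableSet_Ioo fun x hx =>
      mul_nonneg (pow_nonneg hx.1.le _) (neg_nonneg.2 (Real.log_nonpos hx.1.le hx.2.le))
  rw [← ofReal_integral_eq_lintegral_ofReal hint hnn]
  congr 1
  rw [← integral_Ioc_eq_integral_Ioo, ← intervalIntegral.integral_of_le zero_le_one]
  simp only [mul_neg, intervalIntegral.integral_neg, integral_pow_mul_log_zero_one]
  ring

/-- **The outer integral of Penner's computation**: `∫⁻_{(0,1)} (−log x)/(1 − x²) dx = π²/8`,
by term-wise integration (monotone convergence) of `(−log x)/(1−x²) = ∑ₖ x²ᵏ(−log x)` on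
`(0, 1)` and Euler's `∑ 1/(2k+1)² = π²/8`; equivalently `∫₀¹ log x/(1−x²) dx = −π²/8`, the value
used in [Penner 1992, §4.1]. [folklore] -/
theorem lintegral_neg_log_div_one_sub_sq :
    ∫⁻ x in Ioo (0 : ℝ) 1, ENNReal.ofReal (-Real.log x / (1 - x ^ 2)) =
      ENNReal.ofReal (Real.pi ^ 2 / 8) := by
  have hterm : EqOn (fun x : ℝ => ENNReal.ofReal (-Real.log x / (1 - x ^ 2)))
      (fun x => ∑' k : ℕ, ENNReal.ofReal ((x ^ 2) ^ k * -Real.log x)) (Ioo 0 1) := by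
    intro x hx
    have hx2 : x ^ 2 < 1 := by nlinarith [hx.1, hx.2]
    have hlog : 0 ≤ -Real.log x := neg_nonneg.2 (Real.log_nonpos hx.1.le hx.2.le)
    have hs := (hasSum_geometric_of_lt_one (sq_nonneg x) hx2).mul_right (-Real.log x)
    simp only
    rw [← ENNReal.ofReal_tsum_of_nonneg (fun k => mul_nonneg (pow_nonneg (sq_nonneg x) k) hlog)
      hs.summable, hs.tsum_eq]
    congr 1
    rw [div_eq_inv_mul]
  have hfun : (fun n : ℕ => 1 / (((2 * n : ℕ) : ℝ) + 1) ^ 2) =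
      fun k : ℕ => 1 / (2 * (k : ℝ) + 1) ^ 2 := by
    funext k
    push_cast
    ring
  rw [setLIntegral_congr_fun measurableSet_Ioo hterm, lintegral_tsum fun k => ?_]
  · simp_rw [← pow_mul, lintegral_pow_mul_neg_log]
    rw [← ENNReal.ofReal_tsum_of_nonneg (fun k => by positivity)]
    · congr 1
      rw [hfun]
      exact Literature.Analysis.SpecialFunctions.hasSum_one_div_odd_sq.tsum_eq
    · rw [hfun]
      exact Literature.Analysis.SpecialFunctions.hasSum_one_div_odd_sq.summable
  · exact (Measurable.ennreal_ofReal (by fun_prop)).aemeasurable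

/-! ## The inner integration and the slice-wise assembly -/

/-- Penner's integrand `1/((A+B)(½−A)(½−B))` is continuous in `B` on `[0, ½ − A]` when
`0 < A < ½` (all three factors are positive there). [folklore] -/
theorem penner_inner_continuousOn {A : ℝ} (hA : A ∈ Ioo (0 : ℝ) (1 / 2)) :
    ContinuousOn (fun B : ℝ => 1 / ((A + B) * (1 / 2 - A) * (1 / 2 - B)))
      (Icc 0 (1 / 2 - A)) := by
  refine continuousOn_const.div (by fun_prop) fun B hB => ?_
  have h1 : 0 < A + B := by linarith [hA.1, hB.1]
  have h2 : 0 < 1 / 2 - B := by linarith [hA.1, hB.2]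
  have h3 : 0 < 1 / 2 - A := by linarith [hA.2]
  exact (mul_pos (mul_pos h1 h3) h2).ne'

/-- **Penner's inner integration** (the partial-fraction step of [Penner 1992, §4.1]): for
`0 < A < ½`, `∫₀^{½−A} dB/((A+B)(½−A)(½−B)) = −2 log(2A)/((½−A)(½+A))`, from the primitive
`(log(A+B) − log(½−B))/((½−A)(½+A))`, whose derivative is the integrand because
`1/(A+B) + 1/(½−B) = (A+½)/((A+B)(½−B))`. [cite: Penner1992, §4.1] -/
theorem penner_inner_integral {A : ℝ} (hA : A ∈ Ioo (0 : ℝ) (1 / 2)) :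
    ∫ B in (0 : ℝ)..(1 / 2 - A), 1 / ((A + B) * (1 / 2 - A) * (1 / 2 - B)) =
      -2 * Real.log (2 * A) / ((1 / 2 - A) * (1 / 2 + A)) := by
  obtain ⟨hA0, hA1⟩ := hA
  have hle : (0 : ℝ) ≤ 1 / 2 - A := by linarith
  have h3 : (0 : ℝ) < 1 / 2 - A := by linarith
  have h4 : (0 : ℝ) < 1 / 2 + A := by linarith
  have hderiv : ∀ B ∈ uIcc (0 : ℝ) (1 / 2 - A), HasDerivAt
      (fun B : ℝ => (Real.log (A + B) - Real.log (1 / 2 - B)) / ((1 / 2 - A) * (1 / 2 + A)))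
      (1 / ((A + B) * (1 / 2 - A) * (1 / 2 - B))) B := by
    intro B hB
    rw [uIcc_of_le hle] at hB
    have h1 : 0 < A + B := by linarith [hB.1]
    have h2 : 0 < 1 / 2 - B := by linarith [hB.2]
    have hlog1 : HasDerivAt (fun y : ℝ => Real.log (A + y)) (1 / (A + B)) B :=
      ((hasDerivAt_id' B).const_add A).log h1.ne'
    have hlog2 : HasDerivAt (fun y : ℝ => Real.log (1 / 2 - y)) (-1 / (1 / 2 - B)) B :=
      ((hasDerivAt_id' B).const_sub (1 / 2)).log h2.ne'
    have h := (hlog1.sub hlog2).div_const ((1 / 2 - A) * (1 / 2 + A))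
    refine h.congr_deriv ?_
    -- a rational identity in the atoms `s = A + B`, `u = ½ - A`, `v = ½ - B` (`½ + A = s + v`)
    have hw : (1 / 2 : ℝ) + A = (A + B) + (1 / 2 - B) := by ring
    rw [hw]
    generalize A + B = s at h1 ⊢
    generalize 1 / 2 - A = u at h3 ⊢
    generalize 1 / 2 - B = v at h2 ⊢
    have := h1.ne'
    have := h2.ne'
    have := h3.ne'
    have := (add_pos h1 h2).ne'
    field_simp
    ring
  have hint : IntervalIntegrable (fun B : ℝ => 1 / ((A + B) * (1 / 2 - A) * (1 / 2 - B)))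
      volume 0 (1 / 2 - A) := by
    refine ContinuousOn.intervalIntegrable ?_
    rw [uIcc_of_le hle]
    exact penner_inner_continuousOn ⟨hA0, hA1⟩
  rw [intervalIntegral.integral_eq_sub_of_hasDerivAt hderiv hint]
  have e1 : Real.log (A + (1 / 2 - A)) = -Real.log 2 := by
    rw [show A + (1 / 2 - A) = (2 : ℝ)⁻¹ by ring, Real.log_inv]
  have e2 : Real.log (1 / 2 - (1 / 2 - A)) = Real.log A := by
    congr 1
    ring
  have e3 : Real.log ((1 : ℝ) / 2) = -Real.log 2 := by
    rw [one_div, Real.log_inv]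
  have e4 : Real.log (2 * A) = Real.log 2 + Real.log A := Real.log_mul two_ne_zero hA0.ne'
  simp only [add_zero, sub_zero, e1, e2, e3, e4]
  have := h3.ne'
  have := h4.ne'
  field_simp
  ring

/-- Lintegral form of `penner_inner_integral` over the open slice `(0, ½ − A)` (the integrand
is continuous on the closed slice, hence integrable, and positive). [cite: Penner1992, §4.1] -/
theorem penner_inner_lintegral {A : ℝ} (hA : A ∈ Ioo (0 : ℝ) (1 / 2)) :
    ∫⁻ B in Ioo (0 : ℝ) (1 / 2 - A),
        ENNReal.ofReal (1 / ((A + B) * (1 / 2 - A) * (1 / 2 - B))) =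
      ENNReal.ofReal (-2 * Real.log (2 * A) / ((1 / 2 - A) * (1 / 2 + A))) := by
  have hle : (0 : ℝ) ≤ 1 / 2 - A := by linarith [hA.2]
  have hint : IntegrableOn (fun B : ℝ => 1 / ((A + B) * (1 / 2 - A) * (1 / 2 - B)))
      (Ioo 0 (1 / 2 - A)) :=
    (penner_inner_continuousOn hA).integrableOn_Icc.mono_set Ioo_subset_Icc_self
  have hnn : 0 ≤ᵐ[volume.restrict (Ioo (0 : ℝ) (1 / 2 - A))]
      fun B : ℝ => 1 / ((A + B) * (1 / 2 - A) * (1 / 2 - B)) :=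
    ae_restrict_of_forall_mem measurableSet_Ioo fun B hB => by
      have h1 : 0 < A + B := by linarith [hA.1, hB.1]
      have h2 : 0 < 1 / 2 - B := by linarith [hA.1, hB.2]
      have h3 : 0 < 1 / 2 - A := by linarith [hA.2]
      exact (one_div_pos.2 (mul_pos (mul_pos h1 h3) h2)).le
  rw [← ofReal_integral_eq_lintegral_ofReal hint hnn, ← integral_Ioc_eq_integral_Ioo,
    ← intervalIntegral.integral_of_le hle, penner_inner_integral hA]

/-- The homothety `A = x/2` on lintegrals over Lebesgue measure:
`∫⁻_{(0,½)} G(2A) dA = ½ ∫⁻_{(0,1)} G(x) dx` (no measurability needed: `x ↦ 2x` is a measurable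
embedding and `map (2·) volume = ½ • volume`). [folklore] -/
theorem setLIntegral_Ioo_half_comp_two_mul (G : ℝ → ℝ≥0∞) :
    ∫⁻ A in Ioo (0 : ℝ) (1 / 2), G (2 * A) =
      ENNReal.ofReal (1 / 2) * ∫⁻ x in Ioo (0 : ℝ) 1, G x := by
  have he : MeasurableEmbedding (fun x : ℝ => 2 * x) :=
    (MeasurableEquiv.mulLeft₀ (2 : ℝ) two_ne_zero).measurableEmbedding
  have hpre : (fun x : ℝ => 2 * x) ⁻¹' Ioo 0 1 = Ioo 0 (1 / 2) := by
    rw [preimage_const_mul_Ioo₀ _ _ two_pos, zero_div]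
  calc ∫⁻ A in Ioo (0 : ℝ) (1 / 2), G (2 * A)
      = ∫⁻ A in (fun x : ℝ => 2 * x) ⁻¹' Ioo 0 1, G (2 * A) := by rw [hpre]
    _ = ∫⁻ x in Ioo 0 1, G x ∂(Measure.map (fun x : ℝ => 2 * x) volume) := by
        rw [he.restrict_map, he.lintegral_map]
    _ = ENNReal.ofReal (1 / 2) * ∫⁻ x in Ioo (0 : ℝ) 1, G x := by
        rw [Real.map_volume_mul_left two_ne_zero, Measure.restrict_smul, lintegral_smul_measure,
          smul_eq_mul, abs_of_pos (by positivity), one_div]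

/-- **Penner's double integral on `ℝ × ℝ`**: with Lebesgue measure,
`∫⁻_{A,B>0, A+B<½} dA dB/((A+B)(½−A)(½−B)) = π²/2` — Tonelli (slices `B ∈ (0, ½−A)` for
`A ∈ (0, ½)`, empty otherwise), `penner_inner_lintegral`, the homothety `A = x/2`
(`−2 log(2A)/((½−A)(½+A)) = 8 · (−log(2A))/(1−(2A)²)`), and `lintegral_neg_log_div_one_sub_sq`:
`½ · 8 · π²/8 = π²/2`, i.e. Penner's `−4 ∫₀¹ log x/(1−x²) dx`. [cite: Penner1992, §4.1] -/
theorem penner_lintegral_prod :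
    ∫⁻ p in {p : ℝ × ℝ | 0 < p.1 ∧ 0 < p.2 ∧ p.1 + p.2 < 1 / 2},
        ENNReal.ofReal (1 / ((p.1 + p.2) * (1 / 2 - p.1) * (1 / 2 - p.2))) =
      ENNReal.ofReal (Real.pi ^ 2 / 2) := by
  set D : Set (ℝ × ℝ) := {p | 0 < p.1 ∧ 0 < p.2 ∧ p.1 + p.2 < 1 / 2} with hD
  set G : ℝ × ℝ → ℝ≥0∞ :=
    fun p => ENNReal.ofReal (1 / ((p.1 + p.2) * (1 / 2 - p.1) * (1 / 2 - p.2))) with hG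
  have hDm : MeasurableSet D :=
    (measurableSet_lt measurable_const measurable_fst).inter
      ((measurableSet_lt measurable_const measurable_snd).inter
        (measurableSet_lt (measurable_fst.add measurable_snd) measurable_const))
  have hGm : Measurable G := by
    rw [hG]
    fun_prop
  -- the slices of `D`: `(A, B) ∈ D ↔ B ∈ (0, ½ - A)` for `A ∈ (0, ½)`, and `∅` otherwise
  have hslice : ∀ A : ℝ, ∫⁻ B, D.indicator G (A, B) = (Ioo (0 : ℝ) (1 / 2)).indicator
      (fun A => ENNReal.ofReal (-2 * Real.log (2 * A) / ((1 / 2 - A) * (1 / 2 + A)))) A := by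
    intro A
    by_cases hA : A ∈ Ioo (0 : ℝ) (1 / 2)
    · rw [indicator_of_mem hA, ← penner_inner_lintegral hA,
        ← lintegral_indicator measurableSet_Ioo]
      congr 1 with B
      by_cases hB : B ∈ Ioo (0 : ℝ) (1 / 2 - A)
      · have hmem : (A, B) ∈ D := ⟨hA.1, hB.1, by linarith [hB.2]⟩
        rw [indicator_of_mem hmem, indicator_of_mem hB]
      · have hnmem : (A, B) ∉ D := fun h => hB ⟨h.2.1, by linarith [h.2.2]⟩
        rw [indicator_of_notMem hnmem, indicator_of_notMem hB]
    · rw [indicator_of_notMem hA]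
      have h0 : ∀ B, D.indicator G (A, B) = 0 := fun B =>
        indicator_of_notMem (fun h => hA ⟨h.1, by linarith [h.2.1, h.2.2]⟩) _
      simp [h0]
  calc ∫⁻ p in D, G p = ∫⁻ p, D.indicator G p := (lintegral_indicator hDm G).symm
    _ = ∫⁻ A, ∫⁻ B, D.indicator G (A, B) := by
        rw [Measure.volume_eq_prod]
        exact lintegral_prod _ (hGm.indicator hDm).aemeasurable
    _ = ∫⁻ A, (Ioo (0 : ℝ) (1 / 2)).indicator
          (fun A => ENNReal.ofReal (-2 * Real.log (2 * A) / ((1 / 2 - A) * (1 / 2 + A)))) A :=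
        lintegral_congr hslice
    _ = ∫⁻ A in Ioo (0 : ℝ) (1 / 2),
          ENNReal.ofReal (-2 * Real.log (2 * A) / ((1 / 2 - A) * (1 / 2 + A))) :=
        lintegral_indicator measurableSet_Ioo _
    _ = ∫⁻ A in Ioo (0 : ℝ) (1 / 2),
          ENNReal.ofReal (8 * (-Real.log (2 * A) / (1 - (2 * A) ^ 2))) := by
        refine setLIntegral_congr_fun measurableSet_Ioo fun A hA => ?_
        have h3 : (0 : ℝ) < 1 / 2 - A := by linarith [hA.2]
        have h4 : (0 : ℝ) < 1 / 2 + A := by linarith [hA.1]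
        have h5 : (1 : ℝ) - (2 * A) ^ 2 = 4 * ((1 / 2 - A) * (1 / 2 + A)) := by ring
        have hc : (1 / 2 - A) * (1 / 2 + A) ≠ 0 := (mul_pos h3 h4).ne'
        rw [h5]
        generalize (1 / 2 - A) * (1 / 2 + A) = c at hc ⊢
        congr 1
        field_simp
        ring
    _ = ENNReal.ofReal (1 / 2) *
          ∫⁻ x in Ioo (0 : ℝ) 1, ENNReal.ofReal (8 * (-Real.log x / (1 - x ^ 2))) :=
        setLIntegral_Ioo_half_comp_two_mul
          (fun x => ENNReal.ofReal (8 * (-Real.log x / (1 - x ^ 2))))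
    _ = ENNReal.ofReal (1 / 2) * (ENNReal.ofReal 8 *
          ∫⁻ x in Ioo (0 : ℝ) 1, ENNReal.ofReal (-Real.log x / (1 - x ^ 2))) := by
        congr 1
        rw [← lintegral_const_mul' _ _ ENNReal.ofReal_ne_top]
        exact lintegral_congr fun x => ENNReal.ofReal_mul (by norm_num)
    _ = ENNReal.ofReal (Real.pi ^ 2 / 2) := by
        rw [lintegral_neg_log_div_one_sub_sq, ← ENNReal.ofReal_mul (by norm_num),
          ← ENNReal.ofReal_mul (by norm_num)]
        congr 1
        ring

/-! ## The discharge -/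

/-- **Penner's torus integral holds** [Penner 1992, §4.1, the display proving Thm. 4.1.1,
p. 585]: `⅓ ∫_D dA dB/((A+B)(½−A)(½−B)) = π²/6` over `D = {A > 0, B > 0, A + B < ½}` —
discharges the named fact `penner_torus_integral`. Proof: transfer to `ℝ × ℝ`
(`MeasureTheory.volume_preserving_finTwoArrow`), `penner_lintegral_prod` (`∫_D = π²/2`), and the
Bochner/lintegral dictionary for the nonnegative measurable integrand; `⅓ · π²/2 = π²/6`.
[cite: Penner1992, §4.1 and Thm. 4.1.1] -/
theorem penner_torus_integral_holds : penner_torus_integral := by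
  unfold penner_torus_integral
  set D : Set (Fin 2 → ℝ) := {x | 0 < x 0 ∧ 0 < x 1 ∧ x 0 + x 1 < 1 / 2} with hD
  have hDm : MeasurableSet D :=
    (measurableSet_lt measurable_const (measurable_pi_apply 0)).inter
      ((measurableSet_lt measurable_const (measurable_pi_apply 1)).inter
        (measurableSet_lt ((measurable_pi_apply 0).add (measurable_pi_apply 1))
          measurable_const))
  have hnn : 0 ≤ᵐ[volume.restrict D]
      fun x : Fin 2 → ℝ => 1 / ((x 0 + x 1) * (1 / 2 - x 0) * (1 / 2 - x 1)) :=
    ae_restrict_of_forall_mem hDm fun x hx => by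
      obtain ⟨h0, h1, h2⟩ := hx
      have h3 : 0 < 1 / 2 - x 0 := by linarith
      have h4 : 0 < 1 / 2 - x 1 := by linarith
      exact (one_div_pos.2 (mul_pos (mul_pos (add_pos h0 h1) h3) h4)).le
  have hmeas : AEStronglyMeasurable
      (fun x : Fin 2 → ℝ => 1 / ((x 0 + x 1) * (1 / 2 - x 0) * (1 / 2 - x 1)))
      (volume.restrict D) :=
    Measurable.aestronglyMeasurable (by fun_prop)
  have hlin : ∫⁻ x in D, ENNReal.ofReal (1 / ((x 0 + x 1) * (1 / 2 - x 0) * (1 / 2 - x 1))) =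
      ENNReal.ofReal (Real.pi ^ 2 / 2) := by
    have h := (volume_preserving_finTwoArrow ℝ).setLIntegral_comp_preimage_emb
      MeasurableEquiv.finTwoArrow.measurableEmbedding
      (fun p : ℝ × ℝ => ENNReal.ofReal (1 / ((p.1 + p.2) * (1 / 2 - p.1) * (1 / 2 - p.2))))
      {p : ℝ × ℝ | 0 < p.1 ∧ 0 < p.2 ∧ p.1 + p.2 < 1 / 2}
    rw [penner_lintegral_prod] at h
    exact h
  rw [integral_eq_lintegral_of_nonneg_ae hnn hmeas, hlin, ENNReal.toReal_ofReal (by positivity)]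
  ring

end Literature.NumberTheory.Transcendental

/-!
# Part II: the twice-punctured-torus integral `= π⁴/8` (Penner 1992, Prop. 5.1.2, Thm. 5.2.1)

Second half of the sibling proof file of
`Literature.NumberTheory.Transcendental.PennerWeilPeterssonVolumes` (D-0014). It discharges
`Literature.NumberTheory.Transcendental.penner_doubleTorus_integral` — Penner 1992, Prop. 5.1.2
with Thm. 5.2.1: over `D = {xᵢ > 0, Σxᵢ < ½} ⊂ ℝ⁴`,

  `∫_D (1 − Σxᵢ) dx / ((x₁+x₂)(x₃+x₄)(½−x₁−x₃)(½−x₁−x₄)(½−x₂−x₃)(½−x₂−x₄)) = π⁴/8` —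

as `penner_doubleTorus_integral_holds`, so that users holding `(h : penner_doubleTorus_integral)`
(route `KontsevichZagierPeriods/PennerVolumes`, `DoubleTorusValue`) are fed the theorem.

## The source and this file

Penner (*Weil–Petersson volumes*, J. Differential Geom. 35 (1992), §5.2, pp. 588–593) evaluates
the simplex integral of Prop. 5.1.2 by a "computational scheme in the category of folklore in
quantum field theory": Schwinger parameters `1/X = ∫₀^∞ e^{-σX} dσ` for the six linear factors, a
contour-integral formula for `∫_{Δ(s)} exp(linear)`, term-wise expansion of the resulting
logarithms, residues, Gamma/Beta integrals and a terminating `₂F₁` sum, arriving at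
`μ₁² = 8 (Σ_{k odd} k⁻²)² = 8 (π²/8)² = π⁴/8` (Thm. 5.2.1). Contour integration and
hypergeometric bookkeeping are far from Mathlib, so this file runs the SAME skeleton — parametrise
the cross factors, integrate the simplex variables out in closed form, factorise into the square
of a one-dimensional integral worth `2 Σ_{k odd} k⁻²` — through elementary real-variable steps,
all carried out on `ℝ≥0∞`-valued Lebesgue integrals of nonnegative functions (Tonelli throughout,
no integrability side conditions; the Bochner integral of the statement is recovered at the end by
`MeasureTheory.integral_eq_lintegral_of_nonneg_ae`). Write `cᵢ` for the four cross factors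
`c₁ = ½−x₁−x₃, c₂ = ½−x₁−x₄, c₃ = ½−x₂−x₃, c₄ = ½−x₂−x₄` (coordinates are `x 0, …, x 3` in Lean).

1. *Partial fractions and symmetry* (`main_lintegral`, `KL_symm`). `1 − Σxᵢ = c₁ + c₄`, so the
   integrand is `k1 + k2` with `k2 = 1/((x₁+x₂)(x₃+x₄)c₁c₂c₃)` and `k1` its image under the
   coordinate permutation `x₁ ↔ x₂, x₃ ↔ x₄`, which preserves `D` and Lebesgue measure
   (`lintegral_comp_perm`); hence the integral is `2K'`, `K' = ∫_D k2`.
2. *Change of variables* (`lintegral_D_eq`, `KL_eq1`). The polar-pair substitution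
   `psiMap : (s, m, r, n) ↦ (ms, m(1−s), nr, n(1−r))` maps `E = (0,1)² × {m,n>0, m+n<½}`
   diffeomorphically onto `D` with Jacobian `mn = (x₁+x₂)(x₃+x₄)`
   (`MeasureTheory.lintegral_image_eq_lintegral_abs_det_fderiv_mul`, the determinant computed
   from the explicit `4 × 4` Jacobian matrix `psiJac`), leaving `K' = ∫_E dw/(c₁c₂c₃)`.
3. *Feynman parameters* (`feynman_three`, from `lintegral_simplexCube`). For `cᵢ > 0`,
   `1/(c₁c₂c₃) = 2∫_{a,b>0,a+b<1} ((1−a−b)c₁ + bc₃ + ac₂)⁻³ da db`, proved by two applications of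
   the fundamental theorem of calculus with RATIONAL antiderivatives
   (`∫₀ʰ(P+xQ)⁻³ = h(2P+hQ)/(2P²(P+hQ)²)`, then `d/dt[−(L−t)²/(2kL·P·R)]`), so no case split on
   vanishing differences of the `cᵢ` is needed. In the coordinates `w`,
   `(1−a−b)c₁ + bc₃ + ac₂ = ½ − mA − nB`, `A = s+b−2sb`, `B = r+a−2ra`.
4. *Tonelli and the `(m,n)`-integral* (`KL_eq2`, `lintegral_T`, `inner_eq`). Moving `a, b`
   outside and expanding `∫_E` into iterated integrals (`lintegral_fin4_eq`, via
   `MeasureTheory.lmarginal`), the same simplex-cube lemma gives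
   `∫_{m,n>0,m+n<½} (½ − mA − nB)⁻³ = 1/((1−A)(1−B))`, and `1−A = sb+(1−s)(1−b)`,
   `1−B = ra+(1−r)(1−a)`, so the `s`- and `r`-integrals separate:
   `∫_E (…)⁻³ = Φ(b)Φ(a)` with `Φ(a) = ∫₀¹ dr/(ra+(1−r)(1−a))` (`= log(a/(1−a))/(2a−1)`).
5. *Triangle symmetry* (`lintegral_triangle_phiL`). `Φ(1−a) = Φ(a)` and the reflection
   `(a,b) ↦ (1−a,1−b)` give `∫_{a+b<1} Φ(a)Φ(b) = ½(∫₀¹Φ)²`.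
6. *The one-dimensional integral* (`lintegral_phiL`). Averaging over `r ↦ 1−r`,
   `2Φ(a) = ∫₀¹ 4 dr/(1−u²)`, `u = (1−2r)(1−2a)`; expanding the geometric series and integrating
   term-wise (`∫₀¹(1−2x)^{2k} = 1/(2k+1)`) gives `∫₀¹Φ = 2Σ_{k≥0}(2k+1)⁻² = 2·π²/8 = π²/4`, the
   odd-square sum being Euler's (`Literature.Analysis.SpecialFunctions.hasSum_one_div_odd_sq`,
   from Mathlib's `hasSum_zeta_two`). This is Penner's factor `(Σ_{k odd} k⁻²)²`.

Assembling: `∫_D = 2K' = 2·2·½·(π²/4)² = π⁴/8`.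

All auxiliary statements live in the sub-namespace
`Literature.NumberTheory.Transcendental.PennerDoubleTorus`; several (`lintegral_simplexCube`,
`feynman_three`, `lintegral_fin4_eq`, `setLIntegral_Ioo_one_sub`, `lintegral_phiL`) are reusable
for the once-punctured case `penner_torus_integral`, which is NOT treated here.

## References

* R. C. Penner, *Weil–Petersson volumes*, J. Differential Geom. 35 (1992) 559–608 — Prop. 5.1.2
  (the simplex integral for `μ₁²`), §5.2 and Thm. 5.2.1 (`μ₁² = π⁴/8` via Schwinger parameters and
  `8(Σ_{k odd}k⁻²)²`), pp. 588–593 (held, page-checked: `lit read doi-10-4310-jdg-1214448257`,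
  p0030–p0035). [Penner1992]
* S. Wolpert, *On the Kähler form of the moduli space of once punctured tori*, Comment. Math.
  Helv. 58 (1983) 246–256 (the companion value `μ₁¹ = π²/6`). [Wolpert1983]
-/

open Real

namespace Literature.NumberTheory.Transcendental

namespace PennerDoubleTorus

/-- Reflection `x ↦ 1 - x` in a set Lebesgue integral: `∫_{(1-·)⁻¹ S} f(1-x) = ∫_S f`. [folklore] -/
theorem setLIntegral_one_sub (f : ℝ → ℝ≥0∞) (S : Set ℝ) :
    ∫⁻ x in (fun x : ℝ => 1 - x) ⁻¹' S, f (1 - x) = ∫⁻ x in S, f x := by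
  have h := (Measure.measurePreserving_sub_left (volume : Measure ℝ) (1 : ℝ))
  exact h.setLIntegral_comp_preimage_emb (MeasurableEquiv.subLeft (1 : ℝ)).measurableEmbedding f S

/-- Reflection invariance of `∫_{(0,1)}`: `∫₀¹ f(1-x) dx = ∫₀¹ f(x) dx`. [folklore] -/
theorem setLIntegral_Ioo_one_sub (f : ℝ → ℝ≥0∞) :
    ∫⁻ x in Ioo (0 : ℝ) 1, f (1 - x) = ∫⁻ x in Ioo (0 : ℝ) 1, f x := by
  have h := setLIntegral_one_sub f (Ioo 0 1)
  have hS : (fun x : ℝ => 1 - x) ⁻¹' Ioo (0 : ℝ) 1 = Ioo 0 1 := by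
    ext x; simp only [mem_preimage, mem_Ioo]
    constructor <;> rintro ⟨h1, h2⟩ <;> constructor <;> linarith
  rw [hS] at h
  exact h

/-- `∫₀¹ (1-2x)^{2k} dx = 1/(2k+1)`. [folklore] -/
theorem integral_one_sub_two_mul_pow (k : ℕ) :
    ∫ x in (0 : ℝ)..1, (1 - 2 * x) ^ (2 * k) = 1 / (2 * k + 1) := by
  have h := intervalIntegral.integral_comp_sub_mul (fun x : ℝ => x ^ (2 * k)) (two_ne_zero) (1 : ℝ)
    (a := 0) (b := 1)
  rw [h, integral_pow]
  have h1 : (-1 : ℝ) ^ (2 * k + 1) = -1 := by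
    rw [pow_succ, pow_mul]; norm_num
  norm_num [h1]
  field_simp

/-- `∫₀¹ (1-2x)^{2k} dx = 1/(2k+1)`, Lebesgue-integral form. [folklore] -/
theorem lintegral_one_sub_two_mul_pow (k : ℕ) :
    ∫⁻ x in Ioo (0 : ℝ) 1, ENNReal.ofReal ((1 - 2 * x) ^ (2 * k)) =
      ENNReal.ofReal (1 / (2 * k + 1)) := by
  rw [← integral_one_sub_two_mul_pow, intervalIntegral.integral_of_le zero_le_one,
    integral_Ioc_eq_integral_Ioo,
    ofReal_integral_eq_lintegral_ofReal]
  · exact (Continuous.integrableOn_Icc (by fun_prop)).mono_set Ioo_subset_Icc_self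
  · refine ae_of_all _ fun x => ?_
    simp only [Pi.zero_apply]
    rw [pow_mul]
    positivity

/-- The kernel integral `Φ(a) = ∫₀¹ dr / (r a + (1-r)(1-a))` (`= log(a/(1-a))/(2a-1)`), as an
extended nonnegative real. [folklore] -/
noncomputable def phiL (a : ℝ) : ℝ≥0∞ :=
  ∫⁻ r in Ioo (0 : ℝ) 1, ENNReal.ofReal (1 / (r * a + (1 - r) * (1 - a)))

/-- `Φ(1-a) = Φ(a)`. [folklore] -/
theorem phiL_one_sub (a : ℝ) : phiL (1 - a) = phiL a := by
  unfold phiL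
  rw [← setLIntegral_Ioo_one_sub (fun r => ENNReal.ofReal (1 / (r * a + (1 - r) * (1 - a))))]
  refine setLIntegral_congr_fun measurableSet_Ioo fun r _ => ?_
  congr 2
  ring

/-- The kernel `(a, r) ↦ 1/(r a + (1-r)(1-a))` is measurable. [folklore] -/
theorem measurable_phiKernel :
    Measurable fun p : ℝ × ℝ => ENNReal.ofReal (1 / (p.2 * p.1 + (1 - p.2) * (1 - p.1))) := by
  fun_prop

/-- Pointwise: `g(r,a) + g(1-r,a) = 4/(1-u²) = Σ_k 4u^{2k}` with `u = (1-2r)(1-2a)`, where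
`g(r,a) = 1/(ra + (1-r)(1-a))`. [folklore] -/
theorem kernel_add_reflect {a r : ℝ} (ha : a ∈ Ioo (0 : ℝ) 1) (hr : r ∈ Ioo (0 : ℝ) 1) :
    ENNReal.ofReal (1 / (r * a + (1 - r) * (1 - a)))
      + ENNReal.ofReal (1 / ((1 - r) * a + (1 - (1 - r)) * (1 - a)))
      = ∑' k : ℕ, ENNReal.ofReal (4 * ((1 - 2 * r) ^ (2 * k) * (1 - 2 * a) ^ (2 * k))) := by
  obtain ⟨ha0, ha1⟩ := ha
  obtain ⟨hr0, hr1⟩ := hr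
  set u : ℝ := (1 - 2 * r) * (1 - 2 * a) with hu
  have hu1 : u ^ 2 < 1 := by
    have h1 : |1 - 2 * r| < 1 := by rw [abs_lt]; constructor <;> linarith
    have h2 : |1 - 2 * a| < 1 := by rw [abs_lt]; constructor <;> linarith
    have h3 : |u| < 1 := by
      rw [hu, abs_mul]
      calc |1 - 2 * r| * |1 - 2 * a| < 1 * 1 :=
            mul_lt_mul'' h1 h2 (abs_nonneg _) (abs_nonneg _)
        _ = 1 := by ring
    have : u ^ 2 = |u| ^ 2 := (sq_abs u).symm
    rw [this]
    nlinarith [abs_nonneg u]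
  have hpos1 : 0 < r * a + (1 - r) * (1 - a) := by nlinarith
  have hpos2 : 0 < (1 - r) * a + (1 - (1 - r)) * (1 - a) := by nlinarith
  rw [← ENNReal.ofReal_add (by positivity) (by positivity)]
  have hsum : HasSum (fun k : ℕ => 4 * ((1 - 2 * r) ^ (2 * k) * (1 - 2 * a) ^ (2 * k)))
      (1 / (r * a + (1 - r) * (1 - a)) + 1 / ((1 - r) * a + (1 - (1 - r)) * (1 - a))) := by
    have hg := (hasSum_geometric_of_lt_one (sq_nonneg u) hu1).mul_left 4
    have heq : (4 : ℝ) * (1 - u ^ 2)⁻¹ =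
        1 / (r * a + (1 - r) * (1 - a)) + 1 / ((1 - r) * a + (1 - (1 - r)) * (1 - a)) := by
      have e1 : r * a + (1 - r) * (1 - a) = (1 + u) / 2 := by rw [hu]; ring
      have e2 : (1 - r) * a + (1 - (1 - r)) * (1 - a) = (1 - u) / 2 := by rw [hu]; ring
      rw [e1, e2]
      have h1u : 1 + u ≠ 0 := by
        intro h; rw [e1, h] at hpos1; simp at hpos1
      have h2u : 1 - u ≠ 0 := by
        intro h; rw [e2, h] at hpos2; simp at hpos2
      have h3u : 1 - u ^ 2 ≠ 0 := by
        have : 1 - u ^ 2 = (1 + u) * (1 - u) := by ring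
        rw [this]; exact mul_ne_zero h1u h2u
      field_simp
      ring
    rw [heq] at hg
    refine hg.congr_fun fun k => ?_
    rw [hu, mul_pow, mul_pow, ← pow_mul, ← pow_mul]
  rw [← hsum.tsum_eq, ENNReal.ofReal_tsum_of_nonneg ?_ hsum.summable]
  intro k
  have : (0 : ℝ) ≤ (1 - 2 * r) ^ (2 * k) * (1 - 2 * a) ^ (2 * k) := by
    rw [pow_mul, pow_mul]; positivity
  positivity

/-- `2Φ(a) = ∫₀¹ Σ_k 4(1-2r)^{2k}(1-2a)^{2k} dr`. [folklore] -/
theorem two_mul_phiL {a : ℝ} (ha : a ∈ Ioo (0 : ℝ) 1) :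
    2 * phiL a = ∫⁻ r in Ioo (0 : ℝ) 1,
      ∑' k : ℕ, ENNReal.ofReal (4 * ((1 - 2 * r) ^ (2 * k) * (1 - 2 * a) ^ (2 * k))) := by
  have h1 : phiL a = ∫⁻ r in Ioo (0 : ℝ) 1,
      ENNReal.ofReal (1 / ((1 - r) * a + (1 - (1 - r)) * (1 - a))) := by
    unfold phiL
    exact (setLIntegral_Ioo_one_sub
      (fun r => ENNReal.ofReal (1 / (r * a + (1 - r) * (1 - a))))).symm
  rw [two_mul]
  nth_rewrite 2 [h1]
  rw [phiL, ← lintegral_add_left (by fun_prop)]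
  exact setLIntegral_congr_fun measurableSet_Ioo fun r hr => kernel_add_reflect ha hr

/-- **`∫₀¹ Φ = π²/4`**, i.e. `∫₀¹ log(a/(1-a))/(2a-1) da = 2 Σ_{k ≥ 0} 1/(2k+1)² = π²/4`
(term-wise integration of the geometric series; the odd-square sum is Euler's, vendored as
`Literature.Analysis.SpecialFunctions.hasSum_one_div_odd_sq`). This is where Penner's
`(Σ_{k odd} k⁻²)` enters. [folklore] -/
theorem lintegral_phiL : ∫⁻ a in Ioo (0 : ℝ) 1, phiL a = ENNReal.ofReal (π ^ 2 / 4) := by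
  have h2 : 2 * ∫⁻ a in Ioo (0 : ℝ) 1, phiL a = ENNReal.ofReal (π ^ 2 / 2) := by
    rw [← lintegral_const_mul' _ _ ENNReal.ofNat_ne_top]
    rw [setLIntegral_congr_fun measurableSet_Ioo fun a ha => two_mul_phiL ha]
    have hmeas : ∀ k : ℕ, Measurable fun p : ℝ × ℝ =>
        ENNReal.ofReal (4 * ((1 - 2 * p.2) ^ (2 * k) * (1 - 2 * p.1) ^ (2 * k))) := by
      intro k; fun_prop
    have step1 : ∀ a : ℝ, ∫⁻ r in Ioo (0 : ℝ) 1,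
        ∑' k : ℕ, ENNReal.ofReal (4 * ((1 - 2 * r) ^ (2 * k) * (1 - 2 * a) ^ (2 * k)))
        = ∑' k : ℕ, ∫⁻ r in Ioo (0 : ℝ) 1,
            ENNReal.ofReal (4 * ((1 - 2 * r) ^ (2 * k) * (1 - 2 * a) ^ (2 * k))) := by
      intro a
      exact lintegral_tsum fun k => ((hmeas k).comp measurable_prodMk_left).aemeasurable
    simp_rw [step1]
    rw [lintegral_tsum fun k => ?_]
    swap
    · exact ((hmeas k).lintegral_prod_right').aemeasurable
    have step2 : ∀ k : ℕ, ∫⁻ a in Ioo (0 : ℝ) 1, ∫⁻ r in Ioo (0 : ℝ) 1,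
        ENNReal.ofReal (4 * ((1 - 2 * r) ^ (2 * k) * (1 - 2 * a) ^ (2 * k)))
        = ENNReal.ofReal (4 * (1 / (2 * k + 1) ^ 2)) := by
      intro k
      have hnn : ∀ x : ℝ, 0 ≤ (1 - 2 * x) ^ (2 * k) := fun x => by rw [pow_mul]; positivity
      have e1 : ∀ a r : ℝ, ENNReal.ofReal (4 * ((1 - 2 * r) ^ (2 * k) * (1 - 2 * a) ^ (2 * k)))
          = ENNReal.ofReal ((1 - 2 * a) ^ (2 * k)) *
              (ENNReal.ofReal 4 * ENNReal.ofReal ((1 - 2 * r) ^ (2 * k))) := by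
        intro a r
        rw [← ENNReal.ofReal_mul (by norm_num), ← ENNReal.ofReal_mul (hnn a)]
        congr 1; ring
      simp_rw [e1]
      have e2 : ∀ a : ℝ, ∫⁻ r in Ioo (0 : ℝ) 1, ENNReal.ofReal ((1 - 2 * a) ^ (2 * k)) *
          (ENNReal.ofReal 4 * ENNReal.ofReal ((1 - 2 * r) ^ (2 * k)))
          = ENNReal.ofReal ((1 - 2 * a) ^ (2 * k)) *
              (ENNReal.ofReal 4 * ENNReal.ofReal (1 / (2 * k + 1))) := by
        intro a
        rw [lintegral_const_mul' _ _ ENNReal.ofReal_ne_top,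
          lintegral_const_mul' _ _ ENNReal.ofReal_ne_top,
          lintegral_one_sub_two_mul_pow]
      simp_rw [e2]
      rw [lintegral_mul_const' _ _ (by finiteness), lintegral_one_sub_two_mul_pow]
      rw [← ENNReal.ofReal_mul (by norm_num), ← ENNReal.ofReal_mul (by positivity)]
      congr 1
      have hk : (2 : ℝ) * k + 1 ≠ 0 := by positivity
      field_simp
    simp_rw [step2]
    have hs := Literature.Analysis.SpecialFunctions.hasSum_one_div_odd_sq.mul_left 4
    have hs' : HasSum (fun k : ℕ => 4 * (1 / (2 * (k : ℝ) + 1) ^ 2)) (π ^ 2 / 2) := by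
      have e : π ^ 2 / 2 = 4 * (π ^ 2 / 8) := by ring
      rw [e]; exact hs
    rw [← ENNReal.ofReal_tsum_of_nonneg (fun k => by positivity) hs'.summable, hs'.tsum_eq]
  have h2' : (2 : ℝ≥0∞) * ∫⁻ a in Ioo (0 : ℝ) 1, phiL a = 2 * ENNReal.ofReal (π ^ 2 / 4) := by
    rw [h2, ← ENNReal.ofReal_ofNat 2, ← ENNReal.ofReal_mul (by norm_num)]
    congr 1; ring
  exact (ENNReal.mul_right_inj two_ne_zero ENNReal.ofNat_ne_top).1 h2'


/-- `Φ` is measurable. [folklore] -/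
theorem measurable_phiL : Measurable phiL := by
  unfold phiL
  exact measurable_phiKernel.lintegral_prod_right'

/-- The partial integrals `Ψ₁(a) = ∫_{(0,1-a)} Φ` are measurable in `a`. [folklore] -/
theorem measurable_psi1 : Measurable fun a : ℝ => ∫⁻ b in Ioo 0 (1 - a), phiL b := by
  have hT : MeasurableSet {p : ℝ × ℝ | 0 < p.2 ∧ p.2 < 1 - p.1} :=
    (measurableSet_lt measurable_const measurable_snd).inter
      (measurableSet_lt measurable_snd (measurable_const.sub measurable_fst))
  have hK : Measurable fun p : ℝ × ℝ =>
      ({p : ℝ × ℝ | 0 < p.2 ∧ p.2 < 1 - p.1}).indicator (fun p => phiL p.2) p :=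
    (measurable_phiL.comp measurable_snd).indicator hT
  have h := hK.lintegral_prod_right' (ν := volume)
  have heq : (fun a : ℝ => ∫⁻ b in Ioo 0 (1 - a), phiL b) = fun a : ℝ =>
      ∫⁻ b, ({p : ℝ × ℝ | 0 < p.2 ∧ p.2 < 1 - p.1}).indicator (fun p => phiL p.2) (a, b) := by
    funext a
    rw [← lintegral_indicator measurableSet_Ioo]
    exact lintegral_congr fun b => rfl
  rw [heq]
  exact h

/-- Splitting `∫_{(0,1)} = ∫_{(0,1-a)} + ∫_{(1-a,1)}` for `a ∈ (0,1)`. [folklore] -/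
theorem psi_split {a : ℝ} (ha : a ∈ Ioo (0:ℝ) 1) (f : ℝ → ℝ≥0∞) :
    ∫⁻ b in Ioo (0:ℝ) 1, f b = (∫⁻ b in Ioo 0 (1 - a), f b) + ∫⁻ b in Ioo (1 - a) 1, f b := by
  have h1 : 0 < 1 - a := by linarith [ha.2]
  have h2 : 1 - a ≤ 1 := by linarith [ha.1]
  rw [← Ioo_union_Ico_eq_Ioo h1 h2, lintegral_union measurableSet_Ico]
  · rw [setLIntegral_congr (Ioo_ae_eq_Ico (μ := (volume : Measure ℝ)) (a := 1 - a) (b := 1))]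
  · rw [Set.disjoint_left]
    intro x hx hx'
    exact lt_irrefl _ (lt_of_lt_of_le hx.2 hx'.1)

/-- Reflecting the second partial integral: `∫_{(1-a,1)} Φ = ∫_{(0,a)} Φ`. [folklore] -/
theorem psi2_eq {a : ℝ} :
    ∫⁻ b in Ioo (1 - a) 1, phiL b = ∫⁻ b in Ioo 0 (1 - (1 - a)), phiL b := by
  rw [← setLIntegral_one_sub phiL (Ioo (1 - a) 1)]
  have hS : (fun x : ℝ => 1 - x) ⁻¹' Ioo (1 - a) 1 = Ioo 0 (1 - (1 - a)) := by
    ext x; simp only [mem_preimage, mem_Ioo]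
    constructor <;> rintro ⟨h1, h2⟩ <;> constructor <;> linarith
  rw [hS]
  refine setLIntegral_congr_fun measurableSet_Ioo fun x _ => ?_
  exact phiL_one_sub x

/-- **Triangle symmetry**: `∫_{a∈(0,1)} ∫_{b∈(0,1-a)} Φ(b)Φ(a) = ½ (∫₀¹Φ)² = π⁴/32` (the
reflection `(a,b) ↦ (1-a,1-b)` exchanges the two halves of the unit square). [folklore] -/
theorem lintegral_triangle_phiL :
    ∫⁻ a in Ioo (0:ℝ) 1, ∫⁻ b in Ioo 0 (1 - a), phiL b * phiL a
      = ENNReal.ofReal (π ^ 4 / 32) := by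
  set U := ∫⁻ a in Ioo (0:ℝ) 1, ∫⁻ b in Ioo 0 (1 - a), phiL b * phiL a with hU
  set U' := ∫⁻ a in Ioo (0:ℝ) 1, (∫⁻ b in Ioo (1 - a) 1, phiL b) * phiL a with hU'
  have e1 : U = ∫⁻ a in Ioo (0:ℝ) 1, (∫⁻ b in Ioo 0 (1 - a), phiL b) * phiL a := by
    rw [hU]
    refine setLIntegral_congr_fun measurableSet_Ioo fun a _ => ?_
    rw [lintegral_mul_const _ measurable_phiL]
  -- U = U' by the reflection a ↦ 1 - a
  have e2 : U = U' := by
    rw [e1, hU', ← setLIntegral_Ioo_one_sub (fun a => (∫⁻ b in Ioo 0 (1 - a), phiL b) * phiL a)]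
    refine setLIntegral_congr_fun measurableSet_Ioo fun a _ => ?_
    rw [phiL_one_sub, psi2_eq]
  -- U + U' = G₀²
  have e3 : U + U' = ENNReal.ofReal (π ^ 2 / 4) * ENNReal.ofReal (π ^ 2 / 4) := by
    have hm : Measurable fun a => (∫⁻ b in Ioo 0 (1 - a), phiL b) * phiL a :=
      measurable_psi1.mul measurable_phiL
    rw [e1, hU', ← lintegral_add_left hm]
    rw [← lintegral_phiL, ← lintegral_mul_const _ measurable_phiL]
    refine setLIntegral_congr_fun measurableSet_Ioo fun a ha => ?_
    rw [← add_mul, ← psi_split ha, mul_comm]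
  have e4 : (2 : ℝ≥0∞) * U = 2 * ENNReal.ofReal (π ^ 4 / 32) := by
    rw [two_mul, two_mul]
    nth_rewrite 2 [e2]
    rw [e3, ← ENNReal.ofReal_mul (by positivity),
      ← ENNReal.ofReal_add (by positivity) (by positivity)]
    congr 1
    ring
  exact (ENNReal.mul_right_inj two_ne_zero ENNReal.ofNat_ne_top).1 e4



/-- An affine function positive at the endpoints of a segment is positive on it. [folklore] -/
theorem affine_pos_of_endpoints {P Q h x : ℝ} (hP : 0 < P) (hR : 0 < P + h * Q)
    (hx0 : 0 ≤ x) (hxh : x ≤ h) : 0 < P + x * Q := by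
  rcases le_or_gt 0 Q with hQ | hQ
  · nlinarith
  · nlinarith

/-- `d/dx [x(2P+xQ)/(2P²(P+xQ)²)] = (P+xQ)⁻³`. [folklore] -/
theorem hasDerivAt_inner {P Q x : ℝ} (hP : P ≠ 0) (hx : P + x * Q ≠ 0) :
    HasDerivAt (fun x => x * (2 * P + x * Q) / (2 * P ^ 2 * (P + x * Q) ^ 2))
      (((P + x * Q)⁻¹) ^ 3) x := by
  have h1 : HasDerivAt (fun x => x * (2 * P + x * Q)) (1 * (2 * P + x * Q) + x * (1 * Q)) x :=
    (hasDerivAt_id x).mul (((hasDerivAt_id x).mul_const Q).const_add (2 * P))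
  have h2 : HasDerivAt (fun x => 2 * P ^ 2 * (P + x * Q) ^ 2)
      (2 * P ^ 2 * (↑(2 : ℕ) * (P + x * Q) ^ (2 - 1) * (1 * Q))) x :=
    ((((hasDerivAt_id x).mul_const Q).const_add P).pow 2).const_mul (2 * P ^ 2)
  have hD : 2 * P ^ 2 * (P + x * Q) ^ 2 ≠ 0 := by positivity
  have h3 := h1.div h2 hD
  have key : ((1 * (2 * P + x * Q) + x * (1 * Q)) * (2 * P ^ 2 * (P + x * Q) ^ 2) -
        x * (2 * P + x * Q) * (2 * P ^ 2 * (↑(2 : ℕ) * (P + x * Q) ^ (2 - 1) * (1 * Q)))) /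
      (2 * P ^ 2 * (P + x * Q) ^ 2) ^ 2 = (P + x * Q)⁻¹ ^ 3 := by
    norm_num
    field_simp
    ring
  rw [key] at h3
  exact h3

/-- `∫₀ʰ (P+xQ)⁻³ dx = h(2P+hQ)/(2P²(P+hQ)²)` (no division by `Q`). [folklore] -/
theorem integral_inner {P Q h : ℝ} (hP : 0 < P) (hR : 0 < P + h * Q) (hh : 0 ≤ h) :
    ∫ x in (0:ℝ)..h, ((P + x * Q)⁻¹) ^ 3 = h * (2 * P + h * Q) / (2 * P ^ 2 * (P + h * Q) ^ 2) := by
  have hpos : ∀ x ∈ uIcc 0 h, 0 < P + x * Q := by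
    intro x hx
    rw [uIcc_of_le hh] at hx
    exact affine_pos_of_endpoints hP hR hx.1 hx.2
  rw [intervalIntegral.integral_eq_sub_of_hasDerivAt
    (f := fun x => x * (2 * P + x * Q) / (2 * P ^ 2 * (P + x * Q) ^ 2))]
  · simp
  · intro x hx
    exact hasDerivAt_inner hP.ne' (hpos x hx).ne'
  · apply ContinuousOn.intervalIntegrable
    exact ContinuousOn.pow (ContinuousOn.inv₀ (by fun_prop) fun x hx => (hpos x hx).ne') 3

/-- The antiderivative of the outer integrand of the simplex cube integral:
`d/dt [-(L-t)²/(2kL·P·R)] = (L-t)(P+R)/(2P²R²)`, `P = (L-t)u+tk`, `R = (L-t)v+tk`. [folklore] -/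
theorem hasDerivAt_outer {L k u v t : ℝ} (hkL : 2 * k * L ≠ 0) (hP : (L - t) * u + t * k ≠ 0)
    (hR : (L - t) * v + t * k ≠ 0) :
    HasDerivAt
      (fun t => -(L - t) ^ 2 / (2 * k * L * (((L - t) * u + t * k) * ((L - t) * v + t * k))))
      ((L - t) * (((L - t) * u + t * k) + ((L - t) * v + t * k)) /
        (2 * ((L - t) * u + t * k) ^ 2 * ((L - t) * v + t * k) ^ 2)) t := by
  have hLt : HasDerivAt (fun t => L - t) (0 - 1) t := (hasDerivAt_const t L).sub (hasDerivAt_id t)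
  have h1 : HasDerivAt (fun t => -(L - t) ^ 2) (-(↑(2 : ℕ) * (L - t) ^ (2 - 1) * (0 - 1))) t :=
    (hLt.pow 2).neg
  have hP' : HasDerivAt (fun t => (L - t) * u + t * k) ((0 - 1) * u + 1 * k) t :=
    (hLt.mul_const u).add ((hasDerivAt_id t).mul_const k)
  have hR' : HasDerivAt (fun t => (L - t) * v + t * k) ((0 - 1) * v + 1 * k) t :=
    (hLt.mul_const v).add ((hasDerivAt_id t).mul_const k)
  have h2 := ((hP'.mul hR').const_mul (2 * k * L))
  have hD : 2 * k * L * (((L - t) * u + t * k) * ((L - t) * v + t * k)) ≠ 0 := by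
    exact mul_ne_zero hkL (mul_ne_zero hP hR)
  have h3 := h1.div h2 hD
  simp only [Pi.mul_apply] at h3
  have key : (-(↑(2 : ℕ) * (L - t) ^ (2 - 1) * (0 - 1)) *
        (2 * k * L * (((L - t) * u + t * k) * ((L - t) * v + t * k))) -
        -(L - t) ^ 2 * (2 * k * L * (((0 - 1) * u + 1 * k) * ((L - t) * v + t * k) +
          ((L - t) * u + t * k) * ((0 - 1) * v + 1 * k)))) /
      (2 * k * L * (((L - t) * u + t * k) * ((L - t) * v + t * k))) ^ 2 =
      (L - t) * (((L - t) * u + t * k) + ((L - t) * v + t * k)) /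
        (2 * ((L - t) * u + t * k) ^ 2 * ((L - t) * v + t * k) ^ 2) := by
    have h2' : (2 : ℝ) ≠ 0 := two_ne_zero
    have hk : k ≠ 0 := fun h => hkL (by rw [h]; ring)
    have hL : L ≠ 0 := fun h => hkL (by rw [h]; ring)
    norm_num
    field_simp
    ring
  rw [key] at h3
  exact h3

/-- `(L-t)u + tk > 0` for `t ∈ [0,L]`, `L,k,u > 0`. [folklore] -/
theorem linComb_pos {L k u t : ℝ} (hL : 0 < L) (hk : 0 < k) (hu : 0 < u) (ht0 : 0 ≤ t)
    (htL : t ≤ L) :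
    0 < (L - t) * u + t * k := by
  rcases eq_or_lt_of_le ht0 with h | h
  · subst h; nlinarith
  · nlinarith [mul_nonneg (sub_nonneg.2 htL) hu.le, mul_pos h hk]

/-- `∫₀ᴸ (L-t)(P+R)/(2P²R²) dt = 1/(2kLuv)`. [folklore] -/
theorem integral_outer {L k u v : ℝ} (hL : 0 < L) (hk : 0 < k) (hu : 0 < u) (hv : 0 < v) :
    ∫ t in (0:ℝ)..L, (L - t) * (((L - t) * u + t * k) + ((L - t) * v + t * k)) /
        (2 * ((L - t) * u + t * k) ^ 2 * ((L - t) * v + t * k) ^ 2) = 1 / (2 * k * L * u * v) := by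
  have hP : ∀ t ∈ uIcc 0 L, 0 < (L - t) * u + t * k := by
    intro t ht; rw [uIcc_of_le hL.le] at ht; exact linComb_pos hL hk hu ht.1 ht.2
  have hR : ∀ t ∈ uIcc 0 L, 0 < (L - t) * v + t * k := by
    intro t ht; rw [uIcc_of_le hL.le] at ht; exact linComb_pos hL hk hv ht.1 ht.2
  rw [intervalIntegral.integral_eq_sub_of_hasDerivAt
    (f := fun t => -(L - t) ^ 2 / (2 * k * L * (((L - t) * u + t * k) * ((L - t) * v + t * k))))]
  · simp only [sub_self, ne_eq, OfNat.ofNat_ne_zero, not_false_eq_true, zero_pow, neg_zero,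
      zero_mul, zero_add, sub_zero, zero_div, add_zero]
    field_simp
    ring
  · intro t ht
    exact hasDerivAt_outer (by positivity) (hP t ht).ne' (hR t ht).ne'
  · apply ContinuousOn.intervalIntegrable
    refine ContinuousOn.div (by fun_prop) (by fun_prop) fun t ht => ?_
    have := hP t ht; have := hR t ht; positivity

/-- The inner integral of the simplex cube integral in closed form. [folklore] -/
theorem simplexInner_eq {L k u v t : ℝ} (hL : 0 < L) (hk : 0 < k) (hu : 0 < u) (hv : 0 < v)
    (ht : t ∈ Icc 0 L) :
    ∫ x in (0:ℝ)..(L - t), (((L - t - x) * u + x * v + t * k)⁻¹) ^ 3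
      = (L - t) * (((L - t) * u + t * k) + ((L - t) * v + t * k)) /
        (2 * ((L - t) * u + t * k) ^ 2 * ((L - t) * v + t * k) ^ 2) := by
  have hPt : 0 < (L - t) * u + t * k := linComb_pos hL hk hu ht.1 ht.2
  have hRt : 0 < (L - t) * v + t * k := linComb_pos hL hk hv ht.1 ht.2
  have e : ∀ x : ℝ, (L - t - x) * u + x * v + t * k = ((L - t) * u + t * k) + x * (v - u) := by
    intro x; ring
  simp only [e]
  rw [integral_inner hPt (by nlinarith) (by linarith [ht.2])]
  have e2 : (L - t) * u + t * k + (L - t) * (v - u) = (L - t) * v + t * k := by ring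
  rw [e2]
  congr 1
  ring

/-- Positivity of `(L-t-x)u + xv + tk` on the simplex slice. [folklore] -/
theorem simplexIntegrand_pos {L k u v t x : ℝ} (hk : 0 < k) (hu : 0 < u) (hv : 0 < v)
    (ht : 0 < t) (hx : x ∈ Icc 0 (L - t)) : 0 < (L - t - x) * u + x * v + t * k := by
  nlinarith [mul_nonneg (sub_nonneg.2 hx.2) hu.le, mul_nonneg hx.1 hv.le, mul_pos ht hk]

/-- **The simplex cube integral** (Lebesgue-integral form): for `L, k, u, v > 0`,
`∫₀ᴸ ∫₀^{L-t} ((L-t-x)u + xv + tk)⁻³ dx dt = 1/(2kLuv)`, i.e. the Feynman-parameter formula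
`∫_{Δ²} (α₁u + α₂v + α₃k)⁻³ = 1/(2uvk)` scaled to the simplex of size `L`; two applications of the
fundamental theorem of calculus with rational antiderivatives. [folklore] -/
theorem lintegral_simplexCube {L k u v : ℝ} (hL : 0 < L) (hk : 0 < k) (hu : 0 < u) (hv : 0 < v) :
    ∫⁻ t in Ioo 0 L, ∫⁻ x in Ioo 0 (L - t),
        ENNReal.ofReal ((((L - t - x) * u + x * v + t * k)⁻¹) ^ 3)
      = ENNReal.ofReal (1 / (2 * k * L * u * v)) := by
  set F : ℝ → ℝ := fun t => (L - t) * (((L - t) * u + t * k) + ((L - t) * v + t * k)) /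
        (2 * ((L - t) * u + t * k) ^ 2 * ((L - t) * v + t * k) ^ 2) with hF
  have inner : ∀ t ∈ Ioo 0 L, ∫⁻ x in Ioo 0 (L - t),
      ENNReal.ofReal ((((L - t - x) * u + x * v + t * k)⁻¹) ^ 3) = ENNReal.ofReal (F t) := by
    intro t ht
    have hLt : 0 ≤ L - t := by linarith [ht.2]
    have hpos : ∀ x ∈ Icc 0 (L - t), 0 < (L - t - x) * u + x * v + t * k :=
      fun x hx => simplexIntegrand_pos hk hu hv ht.1 hx
    rw [hF]
    dsimp only
    rw [← simplexInner_eq hL hk hu hv ⟨ht.1.le, ht.2.le⟩, intervalIntegral.integral_of_le hLt,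
      integral_Ioc_eq_integral_Ioo, ofReal_integral_eq_lintegral_ofReal]
    · refine (ContinuousOn.integrableOn_Icc ?_).mono_set Ioo_subset_Icc_self
      exact ContinuousOn.pow (ContinuousOn.inv₀ (by fun_prop) fun x hx => (hpos x hx).ne') 3
    · refine (ae_restrict_iff' measurableSet_Ioo).2 (ae_of_all _ fun x hx => ?_)
      have := hpos x (Ioo_subset_Icc_self hx)
      positivity
  rw [setLIntegral_congr_fun measurableSet_Ioo inner]
  have hP : ∀ t ∈ Icc 0 L, 0 < (L - t) * u + t * k := fun t ht => linComb_pos hL hk hu ht.1 ht.2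
  have hR : ∀ t ∈ Icc 0 L, 0 < (L - t) * v + t * k := fun t ht => linComb_pos hL hk hv ht.1 ht.2
  have hFcont : ContinuousOn F (Icc 0 L) := by
    rw [hF]
    refine ContinuousOn.div (by fun_prop) (by fun_prop) fun t ht => ?_
    have := hP t ht; have := hR t ht; positivity
  have hFnn : ∀ t ∈ Icc 0 L, 0 ≤ F t := by
    intro t ht
    have := hP t ht; have := hR t ht; have : 0 ≤ L - t := by linarith [ht.2]
    rw [hF]; positivity
  rw [← integral_outer hL hk hu hv, intervalIntegral.integral_of_le hL.le,
    integral_Ioc_eq_integral_Ioo, ofReal_integral_eq_lintegral_ofReal]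
  · exact hFcont.integrableOn_Icc.mono_set Ioo_subset_Icc_self
  · exact (ae_restrict_iff' measurableSet_Ioo).2
      (ae_of_all _ fun t ht => hFnn t (Ioo_subset_Icc_self ht))

/-- **Feynman parametrisation** `1/(c₁c₂c₃) = 2 ∫_{Δ²} dα/(α₁c₁+α₂c₂+α₃c₃)³` for `cᵢ > 0`
(Lebesgue-integral form; the folklore quantum-field-theory device Penner invokes in §5.2 in its
Schwinger-parameter guise). [folklore] -/
theorem feynman_three {c₁ c₂ c₃ : ℝ} (h₁ : 0 < c₁) (h₂ : 0 < c₂) (h₃ : 0 < c₃) :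
    ENNReal.ofReal (1 / (c₁ * c₂ * c₃)) = 2 * ∫⁻ a in Ioo (0:ℝ) 1, ∫⁻ b in Ioo 0 (1 - a),
        ENNReal.ofReal ((((1 - a - b) * c₁ + b * c₃ + a * c₂)⁻¹) ^ 3) := by
  rw [lintegral_simplexCube one_pos h₂ h₁ h₃, ← ENNReal.ofReal_ofNat 2,
    ← ENNReal.ofReal_mul (by norm_num)]
  congr 1
  field_simp

/-- The `(m, n)`-integral of the main computation:
`∫_{m,n>0, m+n<½} (½ - Am - Bn)⁻³ = 1/((1-A)(1-B))` for `A, B < 1`. [folklore] -/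
theorem lintegral_T {A B : ℝ} (hA : A < 1) (hB : B < 1) :
    ∫⁻ m in Ioo (0:ℝ) (1 / 2), ∫⁻ n in Ioo 0 (1 / 2 - m),
        ENNReal.ofReal ((((1 / 2 - m - n) * 1 + n * (1 - B) + m * (1 - A))⁻¹) ^ 3)
      = ENNReal.ofReal (1 / ((1 - A) * (1 - B))) := by
  rw [lintegral_simplexCube (by norm_num) (by linarith) one_pos (by linarith)]
  congr 1
  field_simp



/-- Penner's domain `D = {xᵢ > 0, Σ xᵢ < ½}` (Prop. 5.1.2). [cite: Penner1992, Prop. 5.1.2] -/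
def D : Set (Fin 4 → ℝ) :=
  {x : Fin 4 → ℝ | 0 < x 0 ∧ 0 < x 1 ∧ 0 < x 2 ∧ 0 < x 3 ∧ x 0 + x 1 + x 2 + x 3 < 1 / 2}

/-- The parameter domain `E = {s ∈ (0,1), r ∈ (0,1), m > 0, n > 0, m + n < ½}` in coordinates
`w = (s, m, r, n) = (w 0, w 1, w 2, w 3)`. [folklore] -/
def E : Set (Fin 4 → ℝ) :=
  {w : Fin 4 → ℝ |
    (0 < w 0 ∧ w 0 < 1) ∧ (0 < w 2 ∧ w 2 < 1) ∧ 0 < w 1 ∧ 0 < w 3 ∧ w 1 + w 3 < 1 / 2}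

/-- The polar-pair substitution `(s, m, r, n) ↦ x = (m s, m (1 - s), n r, n (1 - r))`
(`m = x₁ + x₂`, `n = x₃ + x₄`). [folklore] -/
def psiMap (w : Fin 4 → ℝ) : Fin 4 → ℝ :=
  ![w 1 * w 0, w 1 * (1 - w 0), w 3 * w 2, w 3 * (1 - w 2)]

/-- The Jacobian matrix of `psiMap`. [folklore] -/
def psiJac (w : Fin 4 → ℝ) : Matrix (Fin 4) (Fin 4) ℝ :=
  !![w 1, w 0, 0, 0; -(w 1), 1 - w 0, 0, 0; 0, 0, w 3, w 2; 0, 0, -(w 3), 1 - w 2]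

/-- The derivative of `psiMap` as a continuous linear map. [folklore] -/
noncomputable def psiDeriv (w : Fin 4 → ℝ) : (Fin 4 → ℝ) →L[ℝ] (Fin 4 → ℝ) :=
  LinearMap.toContinuousLinearMap (Matrix.toLin' (psiJac w))

/-- `det (psiJac w) = m n`. [folklore] -/
theorem det_psiJac (w : Fin 4 → ℝ) : (psiJac w).det = w 1 * w 3 := by
  simp [psiJac, Matrix.det_succ_row_zero, Fin.sum_univ_succ, Fin.succAbove]
  ring

/-- `det (psiDeriv w) = m n`. [folklore] -/
theorem det_psiDeriv (w : Fin 4 → ℝ) : (psiDeriv w).det = w 1 * w 3 := by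
  rw [psiDeriv, LinearMap.det_toContinuousLinearMap, LinearMap.det_toLin', det_psiJac]

/-- `psiDeriv` acts as the Jacobian matrix. [folklore] -/
theorem psiDeriv_apply (w h : Fin 4 → ℝ) (i : Fin 4) :
    psiDeriv w h i = ∑ j, psiJac w i j * h j := by
  simp [psiDeriv, Matrix.toLin'_apply, Matrix.mulVec, dotProduct]

/-- `psiMap` has derivative `psiDeriv`. [folklore] -/
theorem hasFDerivAt_psiMap (w : Fin 4 → ℝ) : HasFDerivAt psiMap (psiDeriv w) w := by
  rw [hasFDerivAt_pi']
  intro i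
  fin_cases i
  · have h := (hasFDerivAt_apply (𝕜 := ℝ) (1 : Fin 4) w).mul
      (hasFDerivAt_apply (𝕜 := ℝ) (0 : Fin 4) w)
    have hf : (fun x : Fin 4 → ℝ => psiMap x 0) = fun x => x 1 * x 0 := by
      funext x; simp [psiMap]
    simp only [Fin.zero_eta, Fin.isValue]
    rw [hf]
    refine h.congr_fderiv (ContinuousLinearMap.ext fun v => ?_)
    simp [psiDeriv_apply, psiJac, Fin.sum_univ_four]
  · have h := (hasFDerivAt_apply (𝕜 := ℝ) (1 : Fin 4) w).mul
      ((hasFDerivAt_apply (𝕜 := ℝ) (0 : Fin 4) w).const_sub 1)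
    have hf : (fun x : Fin 4 → ℝ => psiMap x 1) = fun x => x 1 * (1 - x 0) := by
      funext x; simp [psiMap]
    simp only [Fin.mk_one, Fin.isValue]
    rw [hf]
    refine h.congr_fderiv (ContinuousLinearMap.ext fun v => ?_)
    simp [psiDeriv_apply, psiJac, Fin.sum_univ_four]
  · have h := (hasFDerivAt_apply (𝕜 := ℝ) (3 : Fin 4) w).mul
      (hasFDerivAt_apply (𝕜 := ℝ) (2 : Fin 4) w)
    have hf : (fun x : Fin 4 → ℝ => psiMap x 2) = fun x => x 3 * x 2 := by
      funext x; simp [psiMap]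
    simp only [Fin.reduceFinMk, Fin.isValue]
    rw [hf]
    refine h.congr_fderiv (ContinuousLinearMap.ext fun v => ?_)
    simp [psiDeriv_apply, psiJac, Fin.sum_univ_four]
  · have h := (hasFDerivAt_apply (𝕜 := ℝ) (3 : Fin 4) w).mul
      ((hasFDerivAt_apply (𝕜 := ℝ) (2 : Fin 4) w).const_sub 1)
    have hf : (fun x : Fin 4 → ℝ => psiMap x 3) = fun x => x 3 * (1 - x 2) := by
      funext x; simp [psiMap]
    simp only [Fin.reduceFinMk, Fin.isValue]
    rw [hf]
    refine h.congr_fderiv (ContinuousLinearMap.ext fun v => ?_)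
    simp [psiDeriv_apply, psiJac, Fin.sum_univ_four]

/-- `D` is measurable. [folklore] -/
theorem measurableSet_D : MeasurableSet D := by
  unfold D
  measurability

/-- `E` is measurable. [folklore] -/
theorem measurableSet_E : MeasurableSet E := by
  unfold E
  measurability

/-- First component of `psiMap`. [folklore] -/
@[simp] theorem psiMap_zero (w : Fin 4 → ℝ) : psiMap w 0 = w 1 * w 0 := rfl
/-- Second component of `psiMap`. [folklore] -/
@[simp] theorem psiMap_one (w : Fin 4 → ℝ) : psiMap w 1 = w 1 * (1 - w 0) := rfl
/-- Third component of `psiMap`. [folklore] -/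
@[simp] theorem psiMap_two (w : Fin 4 → ℝ) : psiMap w 2 = w 3 * w 2 := rfl
/-- Fourth component of `psiMap`. [folklore] -/
@[simp] theorem psiMap_three (w : Fin 4 → ℝ) : psiMap w 3 = w 3 * (1 - w 2) := rfl

/-- `psiMap` is injective on `E`. [folklore] -/
theorem injOn_psiMap : InjOn psiMap E := by
  intro w hw w' hw' heq
  have h0 := congrFun heq 0
  have h1 := congrFun heq 1
  have h2 := congrFun heq 2
  have h3 := congrFun heq 3
  simp only [psiMap_zero, psiMap_one, psiMap_two, psiMap_three] at h0 h1 h2 h3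
  have hm : w 1 = w' 1 := by linarith
  have hn : w 3 = w' 3 := by linarith
  have hs : w 0 = w' 0 := by
    rw [hm] at h0
    exact mul_left_cancel₀ hw'.2.2.1.ne' h0
  have hr : w 2 = w' 2 := by
    rw [hn] at h2
    exact mul_left_cancel₀ hw'.2.2.2.1.ne' h2
  funext i
  fin_cases i <;> assumption

/-- `psiMap` maps `E` onto Penner's domain `D`. [folklore] -/
theorem image_psiMap : psiMap '' E = D := by
  ext x
  constructor
  · rintro ⟨w, hw, rfl⟩
    obtain ⟨⟨hs0, hs1⟩, ⟨hr0, hr1⟩, hm, hn, hmn⟩ := hw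
    refine ⟨?_, ?_, ?_, ?_, ?_⟩ <;> simp only [psiMap_zero, psiMap_one, psiMap_two, psiMap_three]
    · positivity
    · nlinarith
    · positivity
    · nlinarith
    · nlinarith
  · rintro ⟨h0, h1, h2, h3, hsum⟩
    refine ⟨![x 0 / (x 0 + x 1), x 0 + x 1, x 2 / (x 2 + x 3), x 2 + x 3], ?_, ?_⟩
    · refine ⟨⟨?_, ?_⟩, ⟨?_, ?_⟩, ?_, ?_, ?_⟩ <;> simp
      · positivity
      · rw [div_lt_one (by positivity)]; linarith
      · positivity
      · rw [div_lt_one (by positivity)]; linarith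
      · positivity
      · positivity
      · linarith
    · funext i
      fin_cases i <;> simp [psiMap] <;> field_simp <;> ring

/-- **Change of variables** to polar-pair coordinates: `∫_D g = ∫_E m n · g ∘ psiMap`
(`MeasureTheory.lintegral_image_eq_lintegral_abs_det_fderiv_mul`). [folklore] -/
theorem lintegral_D_eq (g : (Fin 4 → ℝ) → ℝ≥0∞) :
    ∫⁻ x in D, g x = ∫⁻ w in E, ENNReal.ofReal (w 1 * w 3) * g (psiMap w) := by
  rw [← image_psiMap,
    lintegral_image_eq_lintegral_abs_det_fderiv_mul volume measurableSet_E
      (fun w _ => (hasFDerivAt_psiMap w).hasFDerivWithinAt) injOn_psiMap g]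
  refine setLIntegral_congr_fun measurableSet_E fun w hw => ?_
  rw [det_psiDeriv, abs_of_pos (mul_pos hw.2.2.1 hw.2.2.2.1)]



/-- Iterated-integral expansion of a Lebesgue integral over `Fin 4 → ℝ`, peeling the coordinates
in the order `0, 2, 1, 3` (Tonelli via `MeasureTheory.lmarginal`). [folklore] -/
theorem lintegral_fin4_eq (F : (Fin 4 → ℝ) → ℝ≥0∞) (hF : Measurable F) :
    ∫⁻ w, F w = ∫⁻ s : ℝ, ∫⁻ r : ℝ, ∫⁻ m : ℝ, ∫⁻ n : ℝ, F ![s, m, r, n] := by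
  rw [volume_pi, lintegral_eq_lmarginal_univ (0 : Fin 4 → ℝ)]
  have hu : (Finset.univ : Finset (Fin 4)) = insert 0 (insert 2 (insert 1 {3})) := by decide
  rw [hu, lmarginal_insert _ hF (by decide)]
  refine lintegral_congr fun s => ?_
  rw [lmarginal_insert _ hF (by decide)]
  refine lintegral_congr fun r => ?_
  rw [lmarginal_insert _ hF (by decide)]
  refine lintegral_congr fun m => ?_
  rw [lmarginal_singleton]
  refine lintegral_congr fun n => ?_
  congr 1
  funext i
  fin_cases i <;> simp

/-- Invariance of the Lebesgue integral on `Fin 4 → ℝ` under a permutation of coordinates.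
[folklore] -/
theorem lintegral_comp_perm (F : (Fin 4 → ℝ) → ℝ≥0∞) (σ : Equiv.Perm (Fin 4)) :
    ∫⁻ x, F (x ∘ σ) = ∫⁻ x, F x := by
  have h := (volume_preserving_arrowCongr' σ.symm (MeasurableEquiv.refl ℝ)
    (MeasurePreserving.id (volume : Measure ℝ)))
  rw [h.lintegral_map_equiv F]
  congr 1


/-! ### Assembly -/

/-- The `K'`-integrand `1/((x₁+x₂)(x₃+x₄)c₁c₂c₃)`, `c₁ = ½-x₁-x₃`, `c₂ = ½-x₁-x₄`, `c₃ = ½-x₂-x₃`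
(coordinates `x 0, …, x 3`). [folklore] -/
noncomputable def k2 (x : Fin 4 → ℝ) : ℝ :=
  1 / ((x 0 + x 1) * (x 2 + x 3) * (1 / 2 - x 0 - x 2) * (1 / 2 - x 0 - x 3) * (1 / 2 - x 1 - x 2))

/-- Its mirror image `1/((x₁+x₂)(x₃+x₄)c₂c₃c₄)`, `c₄ = ½-x₂-x₄`. [folklore] -/
noncomputable def k1 (x : Fin 4 → ℝ) : ℝ :=
  1 / ((x 0 + x 1) * (x 2 + x 3) * (1 / 2 - x 0 - x 3) * (1 / 2 - x 1 - x 2) * (1 / 2 - x 1 - x 3))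

/-- Penner's integrand `(1 - Σxᵢ)/((x₁+x₂)(x₃+x₄)c₁c₂c₃c₄)` of Prop. 5.1.2, literally the
integrand of `penner_doubleTorus_integral`. [cite: Penner1992, Prop. 5.1.2] -/
noncomputable def pennerIntegrand (x : Fin 4 → ℝ) : ℝ :=
  (1 - (x 0 + x 1 + x 2 + x 3)) /
    ((x 0 + x 1) * (x 2 + x 3) * (1 / 2 - x 0 - x 2) * (1 / 2 - x 0 - x 3) *
      (1 / 2 - x 1 - x 2) * (1 / 2 - x 1 - x 3))

/-- The Feynman-parametrised integrand `((1-a-b)c₁ + bc₃ + ac₂)⁻³ ∘ psiMap` in the coordinates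
`w = (s, m, r, n)`. [folklore] -/
noncomputable def G (a b : ℝ) (w : Fin 4 → ℝ) : ℝ≥0∞ :=
  ENNReal.ofReal ((((1 - a - b) * (1 / 2 - w 1 * w 0 - w 3 * w 2)
    + b * (1 / 2 - w 1 * (1 - w 0) - w 3 * w 2)
    + a * (1 / 2 - w 1 * w 0 - w 3 * (1 - w 2)))⁻¹) ^ 3)

/-- Joint measurability of `G` in `((w, a), b)`. [folklore] -/
theorem measurable_G3 :
    Measurable fun q : ((Fin 4 → ℝ) × ℝ) × ℝ => G q.1.2 q.2 q.1.1 := by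
  unfold G
  fun_prop

/-- Joint measurability of `G a` in `(w, b)`. [folklore] -/
theorem measurable_G2 (a : ℝ) : Measurable fun q : (Fin 4 → ℝ) × ℝ => G a q.2 q.1 := by
  unfold G
  fun_prop

/-- Measurability of `G a b`. [folklore] -/
theorem measurable_G (a b : ℝ) : Measurable (G a b) := by
  unfold G
  fun_prop

/-- Steps 1–2: change of variables (the Jacobian `mn` cancels `(x₁+x₂)(x₃+x₄)`) and Feynman
parametrisation of the three remaining cross factors. [folklore] -/
theorem KL_eq1 : ∫⁻ x in D, ENNReal.ofReal (k2 x)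
    = ∫⁻ w in E, 2 * ∫⁻ a in Ioo (0:ℝ) 1, ∫⁻ b in Ioo 0 (1 - a), G a b w := by
  rw [lintegral_D_eq]
  refine setLIntegral_congr_fun measurableSet_E fun w hw => ?_
  obtain ⟨⟨hs0, hs1⟩, ⟨hr0, hr1⟩, hm, hn, hmn⟩ := hw
  have hms := mul_lt_mul_of_pos_left hs1 hm
  have hnr := mul_lt_mul_of_pos_left hr1 hn
  have hms' : w 1 * (1 - w 0) < w 1 * 1 := mul_lt_mul_of_pos_left (by linarith) hm
  have hnr' : w 3 * (1 - w 2) < w 3 * 1 := mul_lt_mul_of_pos_left (by linarith) hn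
  have hc1 : 0 < 1 / 2 - w 1 * w 0 - w 3 * w 2 := by nlinarith
  have hc2 : 0 < 1 / 2 - w 1 * w 0 - w 3 * (1 - w 2) := by nlinarith
  have hc3 : 0 < 1 / 2 - w 1 * (1 - w 0) - w 3 * w 2 := by nlinarith
  unfold G
  rw [← feynman_three hc1 hc2 hc3, ← ENNReal.ofReal_mul (by positivity)]
  congr 1
  simp only [k2, psiMap_zero, psiMap_one, psiMap_two, psiMap_three]
  have e1 : w 1 * w 0 + w 1 * (1 - w 0) = w 1 := by ring
  have e3 : w 3 * w 2 + w 3 * (1 - w 2) = w 3 := by ring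
  rw [e1, e3]
  have := hm.ne'; have := hn.ne'; have := hc1.ne'; have := hc2.ne'; have := hc3.ne'
  field_simp

/-- Measurability of the partial Feynman integral in `(w, a)`. [folklore] -/
theorem measurable_GI :
    Measurable fun p : (Fin 4 → ℝ) × ℝ => ∫⁻ b in Ioo 0 (1 - p.2), G p.2 b p.1 := by
  have hT : MeasurableSet {q : ((Fin 4 → ℝ) × ℝ) × ℝ | 0 < q.2 ∧ q.2 < 1 - q.1.2} :=
    (measurableSet_lt measurable_const measurable_snd).inter
      (measurableSet_lt measurable_snd (measurable_const.sub (measurable_snd.comp measurable_fst)))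
  have hK : Measurable fun q : ((Fin 4 → ℝ) × ℝ) × ℝ =>
      ({q : ((Fin 4 → ℝ) × ℝ) × ℝ | 0 < q.2 ∧ q.2 < 1 - q.1.2}).indicator
        (fun q => G q.1.2 q.2 q.1.1) q :=
    measurable_G3.indicator hT
  have h := hK.lintegral_prod_right' (ν := volume)
  have heq : (fun p : (Fin 4 → ℝ) × ℝ => ∫⁻ b in Ioo 0 (1 - p.2), G p.2 b p.1)
      = fun p => ∫⁻ b, ({q : ((Fin 4 → ℝ) × ℝ) × ℝ | 0 < q.2 ∧ q.2 < 1 - q.1.2}).indicator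
        (fun q => G q.1.2 q.2 q.1.1) (p, b) := by
    funext p
    rw [← lintegral_indicator measurableSet_Ioo]
    exact lintegral_congr fun b => rfl
  rw [heq]
  exact h

/-- Step 3: Tonelli — the Feynman parameters move outside. [folklore] -/
theorem KL_eq2 : ∫⁻ w in E, 2 * ∫⁻ a in Ioo (0:ℝ) 1, ∫⁻ b in Ioo 0 (1 - a), G a b w
    = 2 * ∫⁻ a in Ioo (0:ℝ) 1, ∫⁻ b in Ioo 0 (1 - a), ∫⁻ w in E, G a b w := by
  rw [lintegral_const_mul' _ _ ENNReal.ofNat_ne_top]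
  congr 1
  rw [lintegral_lintegral_swap measurable_GI.aemeasurable]
  refine lintegral_congr fun a => ?_
  rw [lintegral_lintegral_swap (measurable_G2 a).aemeasurable]

/-- Membership of a coordinate vector in `E`. [folklore] -/
theorem mem_E_vec {s m r n : ℝ} :
    (![s, m, r, n] : Fin 4 → ℝ) ∈ E ↔
      (0 < s ∧ s < 1) ∧ (0 < r ∧ r < 1) ∧ 0 < m ∧ 0 < n ∧ m + n < 1 / 2 := Iff.rfl

/-- The integrand after the substitution as a function of the single coordinates:
`(1-a-b)c₁ + bc₃ + ac₂ = ½ - mA - nB` with `A = s+b-2sb`, `B = r+a-2ra`. [folklore] -/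
noncomputable def H (a b s r m n : ℝ) : ℝ≥0∞ :=
  ENNReal.ofReal ((((1 / 2 - m - n) * 1 + n * (1 - (r + a - 2 * r * a))
    + m * (1 - (s + b - 2 * s * b)))⁻¹) ^ 3)

/-- `G` on a coordinate vector is `H`. [folklore] -/
theorem G_vec (a b s r m n : ℝ) : G a b ![s, m, r, n] = H a b s r m n := by
  simp only [G, H, Matrix.cons_val_zero, Matrix.cons_val_one, Matrix.cons_val]
  congr 3
  ring

/-- The indicator of `E` factors into interval indicators in the single coordinates. [folklore] -/
theorem indicator_E_G (a b s r m n : ℝ) :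
    E.indicator (G a b) ![s, m, r, n] =
      (Ioo (0:ℝ) 1).indicator (fun s => (Ioo (0:ℝ) 1).indicator (fun r =>
        (Ioo (0:ℝ) (1 / 2)).indicator (fun m => (Ioo 0 (1 / 2 - m)).indicator
          (fun n => H a b s r m n) n) m) r) s := by
  by_cases hs : s ∈ Ioo (0:ℝ) 1
  · rw [indicator_of_mem hs]
    by_cases hr : r ∈ Ioo (0:ℝ) 1
    · rw [indicator_of_mem hr]
      by_cases hm : m ∈ Ioo (0:ℝ) (1 / 2)
      · rw [indicator_of_mem hm]
        by_cases hn : n ∈ Ioo 0 (1 / 2 - m)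
        · rw [indicator_of_mem hn, indicator_of_mem, G_vec]
          rw [mem_E_vec]
          exact ⟨hs, hr, hm.1, hn.1, by linarith [hn.2]⟩
        · rw [indicator_of_notMem hn, indicator_of_notMem]
          rw [mem_E_vec]
          rintro ⟨-, -, -, hn0, hmn⟩
          exact hn ⟨hn0, by linarith⟩
      · rw [indicator_of_notMem hm, indicator_of_notMem]
        rw [mem_E_vec]
        rintro ⟨-, -, hm0, hn0, hmn⟩
        exact hm ⟨hm0, by linarith⟩
    · rw [indicator_of_notMem hr, indicator_of_notMem]
      rw [mem_E_vec]
      rintro ⟨-, hr', -⟩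
      exact hr hr'
  · rw [indicator_of_notMem hs, indicator_of_notMem]
    rw [mem_E_vec]
    rintro ⟨hs', -⟩
    exact hs hs'

/-- Peeling four nested interval indicators into set integrals. [folklore] -/
theorem lintegral_indicator4 (K : ℝ → ℝ → ℝ → ℝ → ℝ≥0∞) :
    (∫⁻ s : ℝ, ∫⁻ r : ℝ, ∫⁻ m : ℝ, ∫⁻ n : ℝ,
      (Ioo (0:ℝ) 1).indicator (fun s => (Ioo (0:ℝ) 1).indicator (fun r =>
        (Ioo (0:ℝ) (1 / 2)).indicator (fun m => (Ioo 0 (1 / 2 - m)).indicator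
          (fun n => K s r m n) n) m) r) s)
    = ∫⁻ s in Ioo (0:ℝ) 1, ∫⁻ r in Ioo (0:ℝ) 1, ∫⁻ m in Ioo (0:ℝ) (1 / 2),
        ∫⁻ n in Ioo 0 (1 / 2 - m), K s r m n := by
  rw [← lintegral_indicator measurableSet_Ioo]
  refine lintegral_congr fun s => ?_
  by_cases hs : s ∈ Ioo (0:ℝ) 1
  · simp only [indicator_of_mem hs]
    rw [← lintegral_indicator measurableSet_Ioo]
    refine lintegral_congr fun r => ?_
    by_cases hr : r ∈ Ioo (0:ℝ) 1
    · simp only [indicator_of_mem hr]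
      rw [← lintegral_indicator measurableSet_Ioo]
      refine lintegral_congr fun m => ?_
      by_cases hm : m ∈ Ioo (0:ℝ) (1 / 2)
      · simp only [indicator_of_mem hm]
        rw [← lintegral_indicator measurableSet_Ioo]
      · simp only [indicator_of_notMem hm, lintegral_zero]
    · simp only [indicator_of_notMem hr, lintegral_zero]
  · simp only [indicator_of_notMem hs, lintegral_zero]

/-- Step 4: for fixed Feynman parameters the `w`-integral factorises as `Φ(b)Φ(a)`: the
`(m,n)`-integral is `1/((1-A)(1-B)) = 1/((sb+(1-s)(1-b))(ra+(1-r)(1-a)))` and the `s`- and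
`r`-integrals separate. [folklore] -/
theorem inner_eq {a b : ℝ} (ha : a ∈ Ioo (0:ℝ) 1) (hb : b ∈ Ioo 0 (1 - a)) :
    ∫⁻ w in E, G a b w = phiL b * phiL a := by
  rw [← lintegral_indicator measurableSet_E,
    lintegral_fin4_eq _ ((measurable_G a b).indicator measurableSet_E)]
  simp_rw [indicator_E_G]
  rw [lintegral_indicator4]
  have step : ∀ s ∈ Ioo (0:ℝ) 1, ∀ r ∈ Ioo (0:ℝ) 1,
      ∫⁻ m in Ioo (0:ℝ) (1 / 2), ∫⁻ n in Ioo 0 (1 / 2 - m), H a b s r m n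
      = ENNReal.ofReal (1 / (s * b + (1 - s) * (1 - b))) *
          ENNReal.ofReal (1 / (r * a + (1 - r) * (1 - a))) := by
    intro s hs r hr
    unfold H
    have hA : s + b - 2 * s * b < 1 := by nlinarith [hs.1, hs.2, hb.1, hb.2, ha.1]
    have hB : r + a - 2 * r * a < 1 := by nlinarith [hr.1, hr.2, ha.1, ha.2]
    have hpos : 0 < s * b + (1 - s) * (1 - b) := by nlinarith [hs.1, hs.2, hb.1, hb.2, ha.1]
    rw [lintegral_T hA hB, ← ENNReal.ofReal_mul (by positivity)]
    congr 1
    have h1 : (1 - (s + b - 2 * s * b)) = s * b + (1 - s) * (1 - b) := by ring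
    have h2 : (1 - (r + a - 2 * r * a)) = r * a + (1 - r) * (1 - a) := by ring
    rw [h1, h2, one_div_mul_one_div]
  calc (∫⁻ s in Ioo (0:ℝ) 1, ∫⁻ r in Ioo (0:ℝ) 1, ∫⁻ m in Ioo (0:ℝ) (1 / 2),
          ∫⁻ n in Ioo 0 (1 / 2 - m), H a b s r m n)
      = ∫⁻ s in Ioo (0:ℝ) 1, ∫⁻ r in Ioo (0:ℝ) 1, ENNReal.ofReal (1 / (s * b + (1 - s) * (1 - b))) *
          ENNReal.ofReal (1 / (r * a + (1 - r) * (1 - a))) :=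
        setLIntegral_congr_fun measurableSet_Ioo fun s hs =>
          setLIntegral_congr_fun measurableSet_Ioo fun r hr => step s hs r hr
    _ = ∫⁻ s in Ioo (0:ℝ) 1, ENNReal.ofReal (1 / (s * b + (1 - s) * (1 - b))) * phiL a := by
        refine setLIntegral_congr_fun measurableSet_Ioo fun s _ => ?_
        rw [lintegral_const_mul' _ _ ENNReal.ofReal_ne_top]
        rfl
    _ = phiL b * phiL a := by
        rw [lintegral_mul_const _ (by fun_prop)]
        rfl

/-- Step 5: `K' = ∫_D k2 = 2 · (π⁴/32) = π⁴/16`. [folklore] -/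
theorem KL_value : ∫⁻ x in D, ENNReal.ofReal (k2 x) = ENNReal.ofReal (π ^ 4 / 16) := by
  rw [KL_eq1, KL_eq2]
  have h : (∫⁻ a in Ioo (0:ℝ) 1, ∫⁻ b in Ioo 0 (1 - a), ∫⁻ w in E, G a b w)
      = ∫⁻ a in Ioo (0:ℝ) 1, ∫⁻ b in Ioo 0 (1 - a), phiL b * phiL a :=
    setLIntegral_congr_fun measurableSet_Ioo fun a ha =>
      setLIntegral_congr_fun measurableSet_Ioo fun b hb => inner_eq ha hb
  rw [h, lintegral_triangle_phiL, ← ENNReal.ofReal_ofNat 2, ← ENNReal.ofReal_mul (by norm_num)]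
  congr 1
  ring

/-- Symmetrisation: the coordinate permutation `x₁ ↔ x₂, x₃ ↔ x₄` preserves `D` and carries `k2` to
`k1`, so both have the same integral (Penner's remark on the symmetry group of the integrand,
§5.1). [folklore] -/
theorem KL_symm : ∫⁻ x in D, ENNReal.ofReal (k1 x) = ∫⁻ x in D, ENNReal.ofReal (k2 x) := by
  set σ : Equiv.Perm (Fin 4) := Equiv.swap 0 1 * Equiv.swap 2 3 with hσ
  have hσ0 : σ 0 = 1 := by rw [hσ]; decide
  have hσ1 : σ 1 = 0 := by rw [hσ]; decide
  have hσ2 : σ 2 = 3 := by rw [hσ]; decide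
  have hσ3 : σ 3 = 2 := by rw [hσ]; decide
  rw [← lintegral_indicator measurableSet_D, ← lintegral_indicator measurableSet_D,
    ← lintegral_comp_perm (D.indicator fun x => ENNReal.ofReal (k2 x)) σ]
  refine lintegral_congr fun x => ?_
  have hmem : x ∘ σ ∈ D ↔ x ∈ D := by
    simp only [D, mem_setOf_eq, Function.comp_apply, hσ0, hσ1, hσ2, hσ3]
    constructor
    · rintro ⟨h0, h1, h2, h3, hs⟩; exact ⟨h1, h0, h3, h2, by linarith⟩
    · rintro ⟨h0, h1, h2, h3, hs⟩; exact ⟨h1, h0, h3, h2, by linarith⟩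
  by_cases hx : x ∈ D
  · rw [indicator_of_mem hx, indicator_of_mem (hmem.2 hx)]
    simp only [k1, k2, Function.comp_apply, hσ0, hσ1, hσ2, hσ3]
    congr 1
    ring
  · rw [indicator_of_notMem hx, indicator_of_notMem (mt hmem.1 hx)]

/-- The Lebesgue-integral form of Penner's identity: `∫_D (1-Σx)/(…) = π⁴/8`, from
`1 - Σxᵢ = c₁ + c₄` (partial fractions), symmetrisation and `K' = π⁴/16`.
[cite: Penner1992, Thm. 5.2.1] -/
theorem main_lintegral :
    ∫⁻ x in D, ENNReal.ofReal (pennerIntegrand x) = ENNReal.ofReal (π ^ 4 / 8) := by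
  have hsplit : ∀ x ∈ D, ENNReal.ofReal (pennerIntegrand x)
      = ENNReal.ofReal (k1 x) + ENNReal.ofReal (k2 x) := by
    intro x hx
    obtain ⟨h0, h1, h2, h3, hs⟩ := hx
    have hA : 0 < x 0 + x 1 := by linarith
    have hB : 0 < x 2 + x 3 := by linarith
    have hc1 : 0 < 1 / 2 - x 0 - x 2 := by linarith
    have hc2 : 0 < 1 / 2 - x 0 - x 3 := by linarith
    have hc3 : 0 < 1 / 2 - x 1 - x 2 := by linarith
    have hc4 : 0 < 1 / 2 - x 1 - x 3 := by linarith
    have hk1 : 0 ≤ k1 x := by unfold k1; positivity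
    have hk2 : 0 ≤ k2 x := by unfold k2; positivity
    rw [← ENNReal.ofReal_add hk1 hk2]
    congr 1
    unfold pennerIntegrand k1 k2
    have := hA.ne'; have := hB.ne'
    have g1 : 1 - x 0 * 2 - x 2 * 2 ≠ 0 := by intro h; linarith
    have g2 : 1 - x 0 * 2 - x 3 * 2 ≠ 0 := by intro h; linarith
    have g3 : 1 - x 1 * 2 - x 2 * 2 ≠ 0 := by intro h; linarith
    have g4 : 1 - x 1 * 2 - x 3 * 2 ≠ 0 := by intro h; linarith
    field_simp
    ring
  rw [setLIntegral_congr_fun measurableSet_D hsplit,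
    lintegral_add_left (by unfold k1; fun_prop), KL_symm, KL_value,
    ← ENNReal.ofReal_add (by positivity) (by positivity)]
  congr 1
  ring

end PennerDoubleTorus

open PennerDoubleTorus in
/-- **Penner's twice-punctured-torus integral** (discharge of `penner_doubleTorus_integral`):
`∫_{xᵢ>0, Σxᵢ<½} (1 − Σᵢ xᵢ) dx / ((x₁+x₂)(x₃+x₄)(½−x₁−x₃)(½−x₁−x₄)(½−x₂−x₃)(½−x₂−x₄)) = π⁴/8`,
the Weil–Petersson volume `μ(M₁²)` in Penner's normalisation. Proof: module docstring (partial
fractions + symmetry, polar-pair change of variables, Feynman parameters, triangle symmetry,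
`∫₀¹ log(a/(1−a))/(2a−1) da = π²/4`). [cite: Penner1992, Prop. 5.1.2 and Thm. 5.2.1] -/
theorem penner_doubleTorus_integral_holds : penner_doubleTorus_integral := by
  unfold penner_doubleTorus_integral
  change ∫ x in D, pennerIntegrand x = π ^ 4 / 8
  have hnn : ∀ x ∈ D, 0 ≤ pennerIntegrand x := by
    intro x hx
    obtain ⟨h0, h1, h2, h3, hs⟩ := hx
    have hA : 0 < x 0 + x 1 := by linarith
    have hB : 0 < x 2 + x 3 := by linarith
    have hc1 : 0 < 1 / 2 - x 0 - x 2 := by linarith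
    have hc2 : 0 < 1 / 2 - x 0 - x 3 := by linarith
    have hc3 : 0 < 1 / 2 - x 1 - x 2 := by linarith
    have hc4 : 0 < 1 / 2 - x 1 - x 3 := by linarith
    have hnum : 0 < 1 - (x 0 + x 1 + x 2 + x 3) := by linarith
    unfold pennerIntegrand
    positivity
  have hmeas : Measurable pennerIntegrand := by unfold pennerIntegrand; fun_prop
  rw [integral_eq_lintegral_of_nonneg_ae ((ae_restrict_iff' measurableSet_D).2 (ae_of_all _ hnn))
    hmeas.aestronglyMeasurable, main_lintegral, ENNReal.toReal_ofReal (by positivity)]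

end Literature.NumberTheory.Transcendental

end
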